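import Literature.NumberTheory.LFunctions.VinogradovKorobovInputs
import Literature.NumberTheory.LFunctions.PatelYangNumericsC
import Literature.NumberTheory.LFunctions.PatelSubWeylLowRange
import Literature.NumberTheory.LFunctions.LogZetaConvex
import Literature.Analysis.SpecialFunctions.EulerMascheroniBounds
import Mathlib.NumberTheory.Harmonic.ZetaAsymp
import Mathlib.Analysis.Complex.ExponentialBounds
import Mathlib.Analysis.SpecialFunctions.Log.Deriv
import Mathlib.Analysis.SpecialFunctions.Pow.Deriv
import Mathlib.MeasureTheory.Integral.IntervalIntegral.FundThmCalculus
import Mathlib.Analysis.SpecialFunctions.Integrals.Basic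
import HarnessLib

/-!
# Ramaré's bound `(σ − 1) ζ(σ) ≤ e^{γ(σ−1)}` (`σ > 1`): discharge of `zeta_real_le_ramare`

Topic `Literature/NumberTheory/LFunctions`. Sibling of `VinogradovKorobovInputs.lean`, which vendors
as the NAMED FACT `Literature.NumberTheory.LFunctions.zeta_real_le_ramare` the input (3.2) of
Mossinghoff–Trudgian–Yang: for real `σ > 1`, `ζ(σ) ≤ e^{γ(σ−1)}/(σ − 1)` (`γ` Euler's constant).
This file PROVES it: `Literature.NumberTheory.LFunctions.zeta_real_le_ramare_holds`.

The printed source is G. Bastien, M. Rogalski, *Canad. J. Math.* 54 (2002), p. 918, Lemme 1: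
"([O. Ramaré]) En désignant par `γ` la constante d'Euler, on a, si `s > 1`,
`(s − 1)ζ(s) < e^{γ(s−1)}` (6)", credited to a personal communication of O. Ramaré ([15] there)
whose proof is *not* printed; the authors only say it uses "des évaluations numériques et le
développement classique de `(s − 1)ζ(s)` au voisinage de `1`". The proof below is ours, in that
spirit (the vendored statement is the non-strict form (3.2) of Mossinghoff–Trudgian–Yang).

## Proof

Write `u = σ − 1 > 0` and `T(s) = Σ_{n ≥ 1} ∫_n^{n+1} (x − n) x^{−s−1} dx = ∫_1^∞ {x} x^{−s−1} dx`
(Mathlib's `ZetaAsymptotics.termTSum`), so that `ζ(s) = 1/(s−1) + 1 − s T(s)` for real `s > 1`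
(Mathlib `ZetaAsymptotics.zeta_limit_aux1`) and `T(1) = 1 − γ` (`ZetaAsymptotics.term_tsum_one`);
thus `u ζ(1+u) = 1 + u − u(1+u) T(1+u)`. Three regimes:

* `0 < u ≤ 1/2` (`main_small`): from `x^{−u} = e^{−u log x} ≥ 1 − uℓ + u²ℓ²/2 − u³ℓ³/6`
  (`ℓ = log x ≥ 0`) termwise, `T(1+u) ≥ (1 − γ) − u J₁ + (u²/2) J₂ − (u³/6) J₃` with
  `J_k = ∫_1^∞ {x} logᵏx / x² dx = Σ_m ∫_m^{m+1} (x − m) logᵏx/x² dx`; the bounds `J₁ ≤ 0.5029`,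
  `J₂ ≥ 0.9895`, `J₃ ≤ 3.1` (true values `0.4956`, `1.0009`, `3.0006`) follow from exact evaluation
  of the first unit intervals (antiderivatives `Φ_k`, values of `log 2`, `log 3` from Mathlib) and
  the Chebyshev-type estimates `½∫g − (g(m) − g(m+1))/6 ≤ ∫_m^{m+1}(x−m)g ≤ ½∫g` for `g` antitone
  (`logᵏx/x²` is antitone from `e^{k/2}` on), plus `log³x/x² ≤ 27/(8e³)`; then
  `1 + u − u(1+u)T ≤ 1 + γu + Σ_{k=2}^5 (γu)^k/k! ≤ e^{γu}` is a polynomial inequality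
  (`u²·R(u, γ)`, `R ≥ 0.017` on `[0, 1/2]`, with `γ` to eight places from the tree's
  `EulerMascheroniBounds.lean`).
* `1/2 ≤ u ≤ 1` (`main_mid`): log-convexity of `ζ` on the real axis (the tree's
  `re_riemannZeta_ofReal_le_rpow_mul_rpow`, `LogZetaConvex.lean`) between the certified values
  `ζ(3/2) ≤ 2.627797`, `ζ(5/3) ≤ 2.134002` (ten terms of the Dirichlet series plus the integral
  tail, rational certificates for `n^{−3/2}`, `n^{−5/3}`) and `ζ(2) = π²/6`, against the tangent
  lines at `c = 31/20`, `7/4` of the convex `h(s) = γ(s−1) − log(s−1)` (`glue`; `1 + y ≤ e^y`).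
* `u ≥ 1` (`main_two_le`): `ζ(s) ≤ 1 + 2^{−s} + 2^{1−s}/(s−1)`, `2^{−u}(1 + u/2) ≤ 3/4` and
  `u + 3/4 ≤ 1 + γu + (γu)²/2 + (γu)³/6 ≤ e^{γu}`.

Everything here is proved (no named facts); helper lemmas live in the namespace
`Literature.NumberTheory.LFunctions.ZetaRealLeRamare`.

## References

* G. Bastien, M. Rogalski, *Convexité, complète monotonie et inégalités sur les fonctions zêta et
  gamma, sur les fonctions des opérateurs de Baskakov et sur des fonctions arithmétiques*, Canad.
  J. Math. 54 (2002), 916–944, p. 918, Lemme 1, eq. (6). [cite: BastienRogalski2002, Lemme 1, (6)]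
* M. J. Mossinghoff, T. S. Trudgian, A. Yang, *Explicit zero-free regions for the Riemann
  zeta-function*, Res. Number Theory 10 (2024) = arXiv:2212.06867, (3.2).
  [cite: MossinghoffTrudgianYangRNT2024, (3.2)]
* Mathlib, `Mathlib/NumberTheory/Harmonic/ZetaAsymp.lean` (`ZetaAsymptotics.term`,
  `zeta_limit_aux1`, `term_tsum_one`). [folklore]
* D. Patel, A. Yang, *An explicit sub-Weyl bound for `ζ(1/2 + it)`*, J. Number Theory 262 (2024)
  = arXiv:2302.13444, (1.2) (Patel's thesis bound `|ζ(½+it)| ≤ 307.098|t|^{27/164}`, `|t| ≥ 3`)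
  and §3 (the `ABA³B` argument), used at the end of this file for the discharge
  `Literature.NumberTheory.LFunctions.zeta_half_line_patel_holds`. [cite: PatelYang2024, (1.2)]
-/

noncomputable section

open Real Set MeasureTheory Filter Topology ZetaAsymptotics

namespace Literature.NumberTheory.LFunctions

namespace ZetaRealLeRamare


/-! ### The real Dirichlet series and Mathlib's fractional-part representation -/

/-- `Re ζ(s) = Σ' 1/(n+1)^s` for real `s > 1`. [folklore] -/
theorem re_zeta_eq_tsum_one_div {s : ℝ} (hs : 1 < s) :
    (riemannZeta s).re = ∑' n : ℕ, 1 / ((n : ℝ) + 1) ^ s := by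
  rw [re_riemannZeta_ofReal_eq_tsum hs]
  refine tsum_congr fun n ↦ ?_
  rw [Real.rpow_neg (by positivity), one_div]

/-- `Re ζ(s) = 1/(s-1) + 1 - s·T(s)` with `T = ZetaAsymptotics.termTSum`
(`T(s) = Σ_n ∫_n^{n+1} (x-n) x^{-s-1} dx = ∫_1^∞ {x} x^{-s-1} dx`), real `s > 1`. [folklore] -/
theorem re_zeta_eq {s : ℝ} (hs : 1 < s) :
    (riemannZeta s).re = 1 / (s - 1) + 1 - s * termTSum s := by
  rw [re_zeta_eq_tsum_one_div hs]
  have := zeta_limit_aux1 hs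
  linarith

/-- `term n s ≤ term n 1` for `s ≥ 1` (the integrand decreases in `s` on `x ≥ 1`). [folklore] -/
theorem term_le_term_one {n : ℕ} (hn : 0 < n) {s : ℝ} (hs : 1 ≤ s) : term n s ≤ term n 1 := by
  rw [term, term]
  refine intervalIntegral.integral_mono_on (by linarith) (term_welldef hn (by linarith))
    (term_welldef hn one_pos) fun x hx ↦ ?_
  have hx1 : 1 ≤ x := le_trans (by exact_mod_cast hn) hx.1
  gcongr
  exact sub_nonneg.mpr hx.1

/-- Summability of `n ↦ term (n+1) s` for `s ≥ 1` (dominated by the case `s = 1`). [folklore] -/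
theorem summable_term {s : ℝ} (hs : 1 ≤ s) : Summable fun n : ℕ ↦ term (n + 1) s :=
  Summable.of_nonneg_of_le (fun _ ↦ term_nonneg _ _) (fun n ↦ term_le_term_one n.succ_pos hs)
    term_tsum_one.summable

/-- The elementary upper bound `Re ζ(s) ≤ Σ_{n ≤ N} (n+1)^{-s} + (N+1)^{1-s}/(s-1)` (drop the
terms `n > N` of `T(s) ≥ 0`; Titchmarsh (3.5.3) with the integral discarded). [folklore] -/
theorem re_zeta_le_sum {s : ℝ} (hs : 1 < s) (N : ℕ) :
    (riemannZeta s).re ≤ ∑ n ∈ Finset.range (N + 1), 1 / ((n : ℝ) + 1) ^ s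
      + 1 / (s - 1) * (1 / ((N : ℝ) + 1) ^ (s - 1)) := by
  rw [re_zeta_eq hs]
  have h1 : termSum s N ≤ termTSum s :=
    (summable_term hs.le).sum_le_tsum (Finset.range N) (fun n _ ↦ term_nonneg _ _)
  rw [termSum_of_lt N hs] at h1
  have hs0 : 0 < s := by linarith
  have hs1 : (s - 1) ≠ 0 := by linarith
  have hN : (0:ℝ) < (N:ℝ) + 1 := by positivity
  set P : ℝ := 1 / ((N : ℝ) + 1) ^ s with hP
  have key : 1 / ((N:ℝ) + 1) ^ (s - 1) = ((N:ℝ) + 1) * P := by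
    rw [hP, Real.rpow_sub_one hN.ne']
    field_simp
  have key2 : (N : ℝ) / ((N:ℝ) + 1) ^ s = N * P := by rw [hP]; ring
  rw [key, key2] at h1
  rw [Finset.sum_range_succ, key, ← hP]
  set A : ℝ := ∑ n ∈ Finset.range N, 1 / ((n : ℝ) + 1) ^ s
  have e : A + P + 1 / (s - 1) * (((N:ℝ) + 1) * P) - (1 / (s - 1) + 1 - s * termTSum s)
      = s * (termTSum s - (1 / (s - 1) * (1 - ((N:ℝ) + 1) * P) - 1 / s * (A - N * P))) := by
    field_simp
    ring
  have : 0 ≤ s * (termTSum s - (1 / (s - 1) * (1 - ((N:ℝ) + 1) * P) - 1 / s * (A - N * P))) :=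
    mul_nonneg hs0.le (by linarith)
  linarith

/-- The case `N = 1` of `re_zeta_le_sum`: `Re ζ(s) ≤ 1 + 2^{-s} + 2^{1-s}/(s-1)`. [folklore] -/
theorem re_zeta_le_two_terms {s : ℝ} (hs : 1 < s) :
    (riemannZeta s).re ≤ 1 + 1 / (2:ℝ) ^ s + 1 / (s - 1) * (1 / (2:ℝ) ^ (s - 1)) := by
  have h := re_zeta_le_sum hs 1
  rw [Finset.sum_range_succ, Finset.sum_range_one] at h
  have e1 : (1 : ℝ) / (((0:ℕ):ℝ) + 1) ^ s = 1 := by simp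
  have e2 : (((1:ℕ):ℝ) + 1) = (2:ℝ) := by norm_num
  rw [e1, e2] at h
  exact h

/-! ### Regime `σ ≥ 2` -/

/-- Regime `σ ≥ 2`: `(σ-1) ζ(σ) ≤ (σ-1) + 2^{1-σ}((σ-1)/2 + 1) ≤ (σ-1) + 3/4 ≤ e^{γ(σ-1)}`.
[folklore] -/
theorem main_two_le {σ : ℝ} (hσ : 2 ≤ σ) :
    (riemannZeta σ).re ≤ Real.exp (Real.eulerMascheroniConstant * (σ - 1)) / (σ - 1) := by
  obtain ⟨v, rfl⟩ : ∃ v : ℝ, σ = v + 1 := ⟨σ - 1, by ring⟩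
  have hv1 : 1 ≤ v := by linarith
  have hv0 : 0 < v := by linarith
  have h := re_zeta_le_two_terms (s := v + 1) (by linarith)
  rw [add_sub_cancel_right] at h
  have h2 : (2:ℝ) ^ (v + 1) = 2 ^ v * 2 := Real.rpow_add_one two_ne_zero v
  have hlog2 : (0.6931471803 : ℝ) < Real.log 2 := Real.log_two_gt_d9
  have hexp : 1 + (v - 1) * Real.log 2 ≤ (2:ℝ) ^ (v - 1) := by
    rw [Real.rpow_def_of_pos two_pos]
    have := Real.add_one_le_exp (Real.log 2 * (v - 1))
    linarith
  have h2v : (4 + 2 * v) / 3 ≤ (2:ℝ) ^ v := by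
    have : (2:ℝ) ^ v = 2 * 2 ^ (v - 1) := by
      rw [show v = (v - 1) + 1 by ring, Real.rpow_add_one two_ne_zero]; ring_nf
    rw [this]; nlinarith [hexp, hlog2, hv1]
  have h2pos : 0 < (2:ℝ) ^ v := by positivity
  have hinv : 1 / (2:ℝ) ^ v ≤ 3 / (4 + 2 * v) :=
    one_div_le_one_div_of_le (by positivity) h2v |>.trans (by rw [one_div_div])
  -- (σ - 1) ζ(σ) ≤ v + 3/4
  have hmain : v * (riemannZeta ((v + 1 : ℝ) : ℂ)).re ≤ v + 3 / 4 := by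
    have step : v * (1 + 1 / (2:ℝ) ^ (v + 1) + 1 / v * (1 / (2:ℝ) ^ v))
        = v + (1 / (2:ℝ) ^ v) * (v / 2 + 1) := by
      rw [h2]; field_simp; ring
    have hb : (1 / (2:ℝ) ^ v) * (v / 2 + 1) ≤ 3 / (4 + 2 * v) * (v / 2 + 1) :=
      mul_le_mul_of_nonneg_right hinv (by positivity)
    have hc : 3 / (4 + 2 * v) * (v / 2 + 1) = 3 / 4 := by field_simp; ring
    calc v * (riemannZeta ((v + 1 : ℝ) : ℂ)).re
        ≤ v * (1 + 1 / (2:ℝ) ^ (v + 1) + 1 / v * (1 / (2:ℝ) ^ v)) :=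
          mul_le_mul_of_nonneg_left h hv0.le
      _ = v + (1 / (2:ℝ) ^ v) * (v / 2 + 1) := step
      _ ≤ v + 3 / 4 := by linarith
  -- v + 3/4 ≤ exp(γ v)
  have hg : (0.57721558 : ℝ) < Real.eulerMascheroniConstant :=
    Literature.Analysis.SpecialFunctions.Real.eulerMascheroniConstant_gt_d8
  have hgv : 0.57721558 * v ≤ Real.eulerMascheroniConstant * v := by nlinarith
  have hgv0 : (0:ℝ) ≤ 0.57721558 * v := by positivity
  have hE : 1 + Real.eulerMascheroniConstant * v + (Real.eulerMascheroniConstant * v) ^ 2 / 2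
      + (Real.eulerMascheroniConstant * v) ^ 3 / 6 ≤ Real.exp (Real.eulerMascheroniConstant * v) :=
          by
    have h := Real.sum_le_exp_of_nonneg
      (show (0:ℝ) ≤ Real.eulerMascheroniConstant * v by positivity) 4
    simp only [Finset.sum_range_succ, Finset.sum_range_zero, Nat.factorial] at h
    norm_num at h
    linarith
  have hp2 : (0.57721558 * v) ^ 2 ≤ (Real.eulerMascheroniConstant * v) ^ 2 := pow_le_pow_left₀ hgv0
      hgv 2
  have hp3 : (0.57721558 * v) ^ 3 ≤ (Real.eulerMascheroniConstant * v) ^ 3 := pow_le_pow_left₀ hgv0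
      hgv 3
  have hpoly : v + 3 / 4 ≤ 1 + 0.57721558 * v + (0.57721558 * v) ^ 2 / 2
      + (0.57721558 * v) ^ 3 / 6 := by
    obtain ⟨w, rfl⟩ : ∃ w : ℝ, v = w + 1 := ⟨v - 1, by ring⟩
    have hw : 0 ≤ w := by linarith
    nlinarith [sq_nonneg w, mul_nonneg hw (sq_nonneg w), mul_nonneg hw hw]
  have hfin : v * (riemannZeta ((v + 1 : ℝ) : ℂ)).re ≤ Real.exp (Real.eulerMascheroniConstant * v)
      := by linarith
  rw [add_sub_cancel_right, le_div_iff₀ hv0]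
  linarith

/-! ### Regime `3/2 ≤ σ ≤ 2`: log-convexity between certified values -/

/-- Tangent-line test. The right sides are `exp` of the tangent at `c` to the convex function
`h(s) = γ(s-1) - log(s-1)`; if `log ζ ≤` this tangent at both ends of `[a, b]`, then by the
log-convexity of `ζ` on the real axis (`re_riemannZeta_ofReal_le_rpow_mul_rpow`) and `1 + y ≤ e^y`,
`ζ(s) ≤ e^{γ(s-1)}/(s-1)` on `[a, b]`. [folklore] -/
theorem glue {a b c : ℝ} (ha : 1 < a) (hab : a ≤ b) (hc : 1 < c)
    (hKa : (riemannZeta a).re ≤ Real.exp (Real.eulerMascheroniConstant * (a - 1) + (c - a) /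
        (c - 1)) / (c - 1))
    (hKb : (riemannZeta b).re ≤ Real.exp (Real.eulerMascheroniConstant * (b - 1) + (c - b) /
        (c - 1)) / (c - 1))
    {s : ℝ} (has : a ≤ s) (hsb : s ≤ b) :
    (riemannZeta s).re ≤ Real.exp (Real.eulerMascheroniConstant * (s - 1)) / (s - 1) := by
  have hs1 : 0 < s - 1 := by linarith
  have hc1 : 0 < c - 1 := by linarith
  -- Step 1: `ζ(s) ≤ exp(γ(s-1) + (c-s)/(c-1))/(c-1)`
  have step1 : (riemannZeta s).re ≤ Real.exp (Real.eulerMascheroniConstant * (s - 1) + (c - s) /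
      (c - 1)) / (c - 1) := by
    rcases eq_or_lt_of_le has with rfl | has'
    · exact hKa
    rcases eq_or_lt_of_le hsb with rfl | hsb'
    · exact hKb
    have hb : 1 < b := by linarith
    have hba : 0 < b - a := by linarith
    have ht0 : 0 < (b - s) / (b - a) := div_pos (by linarith) hba
    have ht1 : (b - s) / (b - a) < 1 := (div_lt_one hba).mpr (by linarith)
    have hs_eq : (b - s) / (b - a) * a + (1 - (b - s) / (b - a)) * b = s := by
      field_simp; ring
    have hconv := re_riemannZeta_ofReal_le_rpow_mul_rpow ha hb ht0 ht1
    rw [hs_eq] at hconv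
    have hza : 0 ≤ (riemannZeta a).re := (riemannZeta_re_pos_of_one_lt ha).le
    have hzb : 0 ≤ (riemannZeta b).re := (riemannZeta_re_pos_of_one_lt hb).le
    have hKa' : (riemannZeta a).re
        ≤ Real.exp (Real.eulerMascheroniConstant * (a - 1) + (c - a) / (c - 1) - Real.log (c - 1))
            := by
      rwa [Real.exp_sub, Real.exp_log hc1]
    have hKb' : (riemannZeta b).re
        ≤ Real.exp (Real.eulerMascheroniConstant * (b - 1) + (c - b) / (c - 1) - Real.log (c - 1))
            := by
      rwa [Real.exp_sub, Real.exp_log hc1]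
    calc (riemannZeta s).re
        ≤ (riemannZeta a).re ^ ((b - s) / (b - a))
            * (riemannZeta b).re ^ (1 - (b - s) / (b - a)) := hconv
      _ ≤ Real.exp (Real.eulerMascheroniConstant * (a - 1) + (c - a) / (c - 1) - Real.log (c - 1))
          ^ ((b - s) / (b - a))
            * Real.exp (Real.eulerMascheroniConstant * (b - 1) + (c - b) / (c - 1) - Real.log
                (c - 1))
              ^ (1 - (b - s) / (b - a)) := by
          gcongr
      _ = Real.exp (Real.eulerMascheroniConstant * (s - 1) + (c - s) / (c - 1) - Real.log (c - 1))
          := by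
          rw [← Real.exp_mul, ← Real.exp_mul, ← Real.exp_add]
          congr 1
          field_simp
          ring
      _ = Real.exp (Real.eulerMascheroniConstant * (s - 1) + (c - s) / (c - 1)) / (c - 1) := by
          rw [Real.exp_sub, Real.exp_log hc1]
  -- Step 2: `exp((c-s)/(c-1))/(c-1) ≤ 1/(s-1)` from `1 + y ≤ e^y`, `y = (s-c)/(c-1)`
  have hy : 1 + (s - c) / (c - 1) ≤ Real.exp ((s - c) / (c - 1)) := by
    linarith [Real.add_one_le_exp ((s - c) / (c - 1))]
  have e1 : s - 1 = (c - 1) * (1 + (s - c) / (c - 1)) := by field_simp; ring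
  have hle : s - 1 ≤ (c - 1) * Real.exp ((s - c) / (c - 1)) := by
    rw [e1]; exact mul_le_mul_of_nonneg_left hy hc1.le
  have e2 : Real.exp ((c - s) / (c - 1)) = (Real.exp ((s - c) / (c - 1)))⁻¹ := by
    rw [← Real.exp_neg]; congr 1; ring
  have step2 : Real.exp ((c - s) / (c - 1)) / (c - 1) ≤ 1 / (s - 1) := by
    rw [e2, ← one_div, div_div, one_div_le_one_div (by positivity) hs1, mul_comm]
    exact hle
  calc (riemannZeta s).re ≤ Real.exp (Real.eulerMascheroniConstant * (s - 1) + (c - s) / (c - 1)) /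
      (c - 1) := step1
    _ = Real.exp (Real.eulerMascheroniConstant * (s - 1)) *
        (Real.exp ((c - s) / (c - 1)) / (c - 1)) := by
        rw [Real.exp_add]; ring
    _ ≤ Real.exp (Real.eulerMascheroniConstant * (s - 1)) * (1 / (s - 1)) :=
        mul_le_mul_of_nonneg_left step2 (Real.exp_pos _).le
    _ = Real.exp (Real.eulerMascheroniConstant * (s - 1)) / (s - 1) := by ring

/-- `1/x^e ≤ r` from the integer certificate `1 ≤ r^q x^p` (`e·q = p`). [folklore] -/
theorem one_div_rpow_le {x e r : ℝ} {p q : ℕ} (hx : 0 < x) (hr : 0 < r) (hq : q ≠ 0)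
    (he : e * q = p) (h : 1 ≤ r ^ q * x ^ p) : 1 / x ^ e ≤ r := by
  rw [div_le_iff₀ (Real.rpow_pos_of_pos hx e)]
  refine (one_le_pow_iff_of_nonneg (by positivity) hq).mp ?_
  rw [mul_pow, ← Real.rpow_natCast (x ^ e) q, ← Real.rpow_mul hx.le, he, Real.rpow_natCast]
  exact h

/-- `1 + x + x²/2 + x³/6 + x⁴/24 + x⁵/120 ≤ exp x` for `x ≥ 0`. [folklore] -/
theorem quintic_le_exp {x : ℝ} (hx : 0 ≤ x) :
    1 + x + x ^ 2 / 2 + x ^ 3 / 6 + x ^ 4 / 24 + x ^ 5 / 120 ≤ Real.exp x := by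
  have h := Real.sum_le_exp_of_nonneg hx 6
  simp only [Finset.sum_range_succ, Finset.sum_range_zero, Nat.factorial] at h
  norm_num at h
  linarith

/-- Certified value: `ζ(3/2) ≤ 2.627797` (ten terms and the tail `2·10^{-1/2}`). [folklore] -/
theorem zeta_three_halves_le : (riemannZeta (3 / 2 : ℝ)).re ≤ 2.627797 := by
  have h := re_zeta_le_sum (s := 3 / 2) (by norm_num) 9
  have expand : ∑ n ∈ Finset.range (9 + 1), 1 / ((n : ℝ) + 1) ^ (3 / 2 : ℝ)
      = 1 / 1 ^ (3 / 2 : ℝ) + 1 / 2 ^ (3 / 2 : ℝ) + 1 / 3 ^ (3 / 2 : ℝ) + 1 / 4 ^ (3 / 2 : ℝ)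
        + 1 / 5 ^ (3 / 2 : ℝ) + 1 / 6 ^ (3 / 2 : ℝ) + 1 / 7 ^ (3 / 2 : ℝ) + 1 / 8 ^ (3 / 2 : ℝ)
        + 1 / 9 ^ (3 / 2 : ℝ) + 1 / 10 ^ (3 / 2 : ℝ) := by
    simp only [Finset.sum_range_succ, Finset.sum_range_zero]
    norm_num
  have etail : 1 / (3 / 2 - 1 : ℝ) * (1 / ((9 : ℕ) + 1 : ℝ) ^ (3 / 2 - 1 : ℝ))
      = 2 * (1 / (10 : ℝ) ^ (1 / 2 : ℝ)) := by norm_num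
  rw [expand, etail] at h
  have h1 : 1 / (1 : ℝ) ^ (3 / 2 : ℝ) ≤ 1 := by rw [Real.one_rpow]; norm_num
  have h2 : 1 / (2 : ℝ) ^ (3 / 2 : ℝ) ≤ 176777 / 500000 :=
    one_div_rpow_le (p := 3) (q := 2) (by norm_num) (by norm_num) (by norm_num) (by norm_num)
      (by norm_num)
  have h3 : 1 / (3 : ℝ) ^ (3 / 2 : ℝ) ≤ 192451 / 1000000 :=
    one_div_rpow_le (p := 3) (q := 2) (by norm_num) (by norm_num) (by norm_num) (by norm_num)
      (by norm_num)
  have h4 : 1 / (4 : ℝ) ^ (3 / 2 : ℝ) ≤ 1 / 8 :=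
    one_div_rpow_le (p := 3) (q := 2) (by norm_num) (by norm_num) (by norm_num) (by norm_num)
      (by norm_num)
  have h5 : 1 / (5 : ℝ) ^ (3 / 2 : ℝ) ≤ 89443 / 1000000 :=
    one_div_rpow_le (p := 3) (q := 2) (by norm_num) (by norm_num) (by norm_num) (by norm_num)
      (by norm_num)
  have h6 : 1 / (6 : ℝ) ^ (3 / 2 : ℝ) ≤ 34021 / 500000 :=
    one_div_rpow_le (p := 3) (q := 2) (by norm_num) (by norm_num) (by norm_num) (by norm_num)
      (by norm_num)
  have h7 : 1 / (7 : ℝ) ^ (3 / 2 : ℝ) ≤ 10799 / 200000 :=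
    one_div_rpow_le (p := 3) (q := 2) (by norm_num) (by norm_num) (by norm_num) (by norm_num)
      (by norm_num)
  have h8 : 1 / (8 : ℝ) ^ (3 / 2 : ℝ) ≤ 8839 / 200000 :=
    one_div_rpow_le (p := 3) (q := 2) (by norm_num) (by norm_num) (by norm_num) (by norm_num)
      (by norm_num)
  have h9 : 1 / (9 : ℝ) ^ (3 / 2 : ℝ) ≤ 18519 / 500000 :=
    one_div_rpow_le (p := 3) (q := 2) (by norm_num) (by norm_num) (by norm_num) (by norm_num)
      (by norm_num)
  have h10 : 1 / (10 : ℝ) ^ (3 / 2 : ℝ) ≤ 31623 / 1000000 :=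
    one_div_rpow_le (p := 3) (q := 2) (by norm_num) (by norm_num) (by norm_num) (by norm_num)
      (by norm_num)
  have ht : 1 / (10 : ℝ) ^ (1 / 2 : ℝ) ≤ 79057 / 250000 :=
    one_div_rpow_le (p := 1) (q := 2) (by norm_num) (by norm_num) (by norm_num) (by norm_num)
      (by norm_num)
  linarith

/-- Certified value: `ζ(5/3) ≤ 2.134002`. [folklore] -/
theorem zeta_five_thirds_le : (riemannZeta (5 / 3 : ℝ)).re ≤ 2.134002 := by
  have h := re_zeta_le_sum (s := 5 / 3) (by norm_num) 9
  have expand : ∑ n ∈ Finset.range (9 + 1), 1 / ((n : ℝ) + 1) ^ (5 / 3 : ℝ)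
      = 1 / 1 ^ (5 / 3 : ℝ) + 1 / 2 ^ (5 / 3 : ℝ) + 1 / 3 ^ (5 / 3 : ℝ) + 1 / 4 ^ (5 / 3 : ℝ)
        + 1 / 5 ^ (5 / 3 : ℝ) + 1 / 6 ^ (5 / 3 : ℝ) + 1 / 7 ^ (5 / 3 : ℝ) + 1 / 8 ^ (5 / 3 : ℝ)
        + 1 / 9 ^ (5 / 3 : ℝ) + 1 / 10 ^ (5 / 3 : ℝ) := by
    simp only [Finset.sum_range_succ, Finset.sum_range_zero]
    norm_num
  have etail : 1 / (5 / 3 - 1 : ℝ) * (1 / ((9 : ℕ) + 1 : ℝ) ^ (5 / 3 - 1 : ℝ))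
      = 3 / 2 * (1 / (10 : ℝ) ^ (2 / 3 : ℝ)) := by norm_num
  rw [expand, etail] at h
  have h1 : 1 / (1 : ℝ) ^ (5 / 3 : ℝ) ≤ 1 := by rw [Real.one_rpow]; norm_num
  have h2 : 1 / (2 : ℝ) ^ (5 / 3 : ℝ) ≤ 314981 / 1000000 :=
    one_div_rpow_le (p := 5) (q := 3) (by norm_num) (by norm_num) (by norm_num) (by norm_num)
      (by norm_num)
  have h3 : 1 / (3 : ℝ) ^ (5 / 3 : ℝ) ≤ 641 / 4000 :=
    one_div_rpow_le (p := 5) (q := 3) (by norm_num) (by norm_num) (by norm_num) (by norm_num)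
      (by norm_num)
  have h4 : 1 / (4 : ℝ) ^ (5 / 3 : ℝ) ≤ 99213 / 1000000 :=
    one_div_rpow_le (p := 5) (q := 3) (by norm_num) (by norm_num) (by norm_num) (by norm_num)
      (by norm_num)
  have h5 : 1 / (5 : ℝ) ^ (5 / 3 : ℝ) ≤ 171 / 2500 :=
    one_div_rpow_le (p := 5) (q := 3) (by norm_num) (by norm_num) (by norm_num) (by norm_num)
      (by norm_num)
  have h6 : 1 / (6 : ℝ) ^ (5 / 3 : ℝ) ≤ 12619 / 250000 :=
    one_div_rpow_le (p := 5) (q := 3) (by norm_num) (by norm_num) (by norm_num) (by norm_num)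
      (by norm_num)
  have h7 : 1 / (7 : ℝ) ^ (5 / 3 : ℝ) ≤ 122 / 3125 :=
    one_div_rpow_le (p := 5) (q := 3) (by norm_num) (by norm_num) (by norm_num) (by norm_num)
      (by norm_num)
  have h8 : 1 / (8 : ℝ) ^ (5 / 3 : ℝ) ≤ 1 / 32 :=
    one_div_rpow_le (p := 5) (q := 3) (by norm_num) (by norm_num) (by norm_num) (by norm_num)
      (by norm_num)
  have h9 : 1 / (9 : ℝ) ^ (5 / 3 : ℝ) ≤ 25681 / 1000000 :=
    one_div_rpow_le (p := 5) (q := 3) (by norm_num) (by norm_num) (by norm_num) (by norm_num)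
      (by norm_num)
  have h10 : 1 / (10 : ℝ) ^ (5 / 3 : ℝ) ≤ 4309 / 200000 :=
    one_div_rpow_le (p := 5) (q := 3) (by norm_num) (by norm_num) (by norm_num) (by norm_num)
      (by norm_num)
  have ht : 1 / (10 : ℝ) ^ (2 / 3 : ℝ) ≤ 53861 / 250000 :=
    one_div_rpow_le (p := 2) (q := 3) (by norm_num) (by norm_num) (by norm_num) (by norm_num)
      (by norm_num)
  linarith

/-- `ζ(2) = π²/6 ≤ 1.654`. [folklore] -/
theorem zeta_two_le : (riemannZeta (2 : ℝ)).re ≤ 1.654 := by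
  have h : riemannZeta ((2 : ℝ) : ℂ) = (π : ℂ) ^ 2 / 6 := by exact_mod_cast riemannZeta_two
  have hre : (riemannZeta ((2 : ℝ) : ℂ)).re = π ^ 2 / 6 := by
    rw [h]; norm_cast
  rw [hre]
  have := Real.pi_lt_d2
  nlinarith [Real.pi_pos]

/-- One endpoint of a tangent-line test, reduced to rational arithmetic: `K(c-1) ≤ T₅(x₀)`,
`T₅` the quintic Taylor polynomial of `exp`, `0 ≤ x₀ ≤ γ(a-1) + (c-a)/(c-1)`. [folklore] -/
theorem endpoint_check {a c K x₀ : ℝ} (hK : (riemannZeta a).re ≤ K) (hc : 1 < c) (hx₀ : 0 ≤ x₀)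
    (hx : x₀ ≤ Real.eulerMascheroniConstant * (a - 1) + (c - a) / (c - 1))
    (hnum : K * (c - 1) ≤ 1 + x₀ + x₀ ^ 2 / 2 + x₀ ^ 3 / 6 + x₀ ^ 4 / 24 + x₀ ^ 5 / 120) :
    (riemannZeta a).re ≤ Real.exp (Real.eulerMascheroniConstant * (a - 1) + (c - a) / (c - 1)) /
        (c - 1) := by
  have hc1 : 0 < c - 1 := by linarith
  rw [le_div_iff₀ hc1]
  calc (riemannZeta a).re * (c - 1) ≤ K * (c - 1) := mul_le_mul_of_nonneg_right hK hc1.le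
    _ ≤ 1 + x₀ + x₀ ^ 2 / 2 + x₀ ^ 3 / 6 + x₀ ^ 4 / 24 + x₀ ^ 5 / 120 := hnum
    _ ≤ Real.exp x₀ := quintic_le_exp hx₀
    _ ≤ Real.exp (Real.eulerMascheroniConstant * (a - 1) + (c - a) / (c - 1)) :=
        Real.exp_le_exp.mpr hx

/-- Regime `3/2 ≤ σ ≤ 2`, from the three certified values by two tangent-line tests
(`c = 31/20` on `[3/2, 5/3]`, `c = 7/4` on `[5/3, 2]`). [folklore] -/
theorem main_mid {σ : ℝ} (h1 : 3 / 2 ≤ σ) (h2 : σ ≤ 2) :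
    (riemannZeta σ).re ≤ Real.exp (Real.eulerMascheroniConstant * (σ - 1)) / (σ - 1) := by
  have hg : (0.57721558 : ℝ) < Real.eulerMascheroniConstant :=
    Literature.Analysis.SpecialFunctions.Real.eulerMascheroniConstant_gt_d8
  rcases le_total σ (5 / 3) with h53 | h53
  · refine glue (a := 3 / 2) (b := 5 / 3) (c := 31 / 20) (by norm_num) (by norm_num) (by norm_num)
      ?_ ?_ h1 h53
    · exact endpoint_check (x₀ := 0.57721558 * (3 / 2 - 1) + (31 / 20 - 3 / 2) / (31 / 20 - 1))
        zeta_three_halves_le (by norm_num) (by norm_num) (by linarith) (by norm_num)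
    · exact endpoint_check (x₀ := 0.57721558 * (5 / 3 - 1) + (31 / 20 - 5 / 3) / (31 / 20 - 1))
        zeta_five_thirds_le (by norm_num) (by norm_num) (by linarith) (by norm_num)
  · refine glue (a := 5 / 3) (b := 2) (c := 7 / 4) (by norm_num) (by norm_num) (by norm_num)
      ?_ ?_ h53 h2
    · exact endpoint_check (x₀ := 0.57721558 * (5 / 3 - 1) + (7 / 4 - 5 / 3) / (7 / 4 - 1))
        zeta_five_thirds_le (by norm_num) (by norm_num) (by linarith) (by norm_num)
    · exact endpoint_check (x₀ := 0.57721558 * (2 - 1) + (7 / 4 - 2) / (7 / 4 - 1))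
        zeta_two_le (by norm_num) (by norm_num) (by linarith) (by norm_num)

/-! ### Regime `1 < σ ≤ 3/2`: Taylor expansion at `σ = 1`

#### Calculus lemmas -/

/-- `f(0) = 0` and `f' ≥ 0` on `[0, ∞)` give `f ≥ 0` on `[0, ∞)`. [folklore] -/
theorem nonneg_of_hasDerivAt_nonneg {f f' : ℝ → ℝ} (hf : ∀ x, HasDerivAt f (f' x) x)
    (hf' : ∀ x, 0 ≤ x → 0 ≤ f' x) (h0 : f 0 = 0) {v : ℝ} (hv : 0 ≤ v) : 0 ≤ f v := by
  have hmono : MonotoneOn f (Ici 0) :=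
    monotoneOn_of_deriv_nonneg (convex_Ici 0) (fun x _ ↦ (hf x).continuousAt.continuousWithinAt)
      (fun x _ ↦ (hf x).differentiableAt.differentiableWithinAt)
      (fun x hx ↦ by rw [(hf x).deriv]; exact hf' x (interior_subset hx))
  have := hmono (self_mem_Ici) hv hv
  rwa [h0] at this

/-- `q₂(v) = 1 - v + v²/2 - e^{-v}` has derivative `-1 + v + e^{-v}`. [folklore] -/
theorem hasDerivAt_q2 (x : ℝ) :
    HasDerivAt (fun v ↦ 1 - v + v * v / 2 - Real.exp (-v)) (-1 + x + Real.exp (-x)) x := by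
  have h := ((((hasDerivAt_id' x).const_sub 1).fun_add
    (((hasDerivAt_id' x).fun_mul (hasDerivAt_id' x)).div_const 2))).fun_sub
    ((hasDerivAt_neg x).exp)
  exact h.congr_deriv (by ring)

/-- `q₃(v) = e^{-v} - (1 - v + v²/2 - v³/6)` has derivative `q₂(v)`. [folklore] -/
theorem hasDerivAt_q3 (x : ℝ) :
    HasDerivAt (fun v ↦ Real.exp (-v) - (1 - v + v * v / 2 - v * v * v / 6))
      (1 - x + x * x / 2 - Real.exp (-x)) x := by
  have h := ((hasDerivAt_neg x).exp).fun_sub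
    ((((hasDerivAt_id' x).const_sub 1).fun_add
      (((hasDerivAt_id' x).fun_mul (hasDerivAt_id' x)).div_const 2)).fun_sub
      ((((hasDerivAt_id' x).fun_mul (hasDerivAt_id' x)).fun_mul (hasDerivAt_id' x)).div_const 6))
  exact h.congr_deriv (by ring)

/-- `q₂ ≥ 0` on `[0, ∞)`, i.e. `e^{-v} ≤ 1 - v + v²/2`. [folklore] -/
theorem q2_nonneg {v : ℝ} (hv : 0 ≤ v) : 0 ≤ 1 - v + v * v / 2 - Real.exp (-v) :=
  nonneg_of_hasDerivAt_nonneg hasDerivAt_q2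
    (fun x _ ↦ by have := Real.add_one_le_exp (-x); linarith) (by simp) hv

/-- `q₃ ≥ 0` on `[0, ∞)`, i.e. `1 - v + v²/2 - v³/6 ≤ e^{-v}`. [folklore] -/
theorem q3_nonneg {v : ℝ} (hv : 0 ≤ v) :
    0 ≤ Real.exp (-v) - (1 - v + v * v / 2 - v * v * v / 6) :=
  nonneg_of_hasDerivAt_nonneg hasDerivAt_q3 (fun _ hx ↦ q2_nonneg hx)
    (by simp) hv

/-- `1 - v + v²/2 - v³/6 ≤ exp(-v)` for `v ≥ 0`. [folklore] -/
theorem cubic_le_exp_neg {v : ℝ} (hv : 0 ≤ v) :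
    1 - v + v ^ 2 / 2 - v ^ 3 / 6 ≤ Real.exp (-v) := by
  have h := q3_nonneg hv
  nlinarith

/-! #### The functions `g_k = logᵏ x/x²` and their antiderivatives

Conventions of this section (everything is written out explicitly, no auxiliary definitions):
* `g_k(x) = logᵏ x / x²` appears as `Real.log x ^ k / x ^ 2`;
* `F₁(x) = (log x + 1)/x`, `F₂(x) = (log² x + 2 log x + 2)/x`,
  `F₃(x) = (log³ x + 3 log² x + 6 log x + 6)/x` are antiderivatives of `-g₁, -g₂, -g₃` on `(0, ∞)`;
* `Φ_k(m, x) = log^{k+1} x/(k+1) + m F_k(x)` is an antiderivative in `x` of `(x - m) g_k(x)`;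
* `A_k(m) = ∫_m^{m+1} (t - m) g_k(t) dt` (`m : ℕ`, written as an interval integral with the casts
  `((m : ℕ) : ℝ)`), so that `J_k = Σ_{m ≥ 1} A_k(m)`. -/

/-- `F₁' = -g₁` (`x > 0`). [folklore] -/
theorem hasDerivAt_F1 {x : ℝ} (hx : 0 < x) : HasDerivAt (fun y ↦ ((Real.log y + 1) / y))
    (-(Real.log x ^ 1 / x ^ 2)) x := by
  have hl := Real.hasDerivAt_log hx.ne'
  have h := (hl.add_const 1).fun_div (hasDerivAt_id' x) hx.ne'
  refine h.congr_deriv ?_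
  field_simp
  ring

/-- `F₂' = -g₂` (`x > 0`). [folklore] -/
theorem hasDerivAt_F2 {x : ℝ} (hx : 0 < x) : HasDerivAt
    (fun y ↦ ((Real.log y ^ 2 + 2 * Real.log y + 2) / y)) (-(Real.log x ^ 2 / x ^ 2)) x := by
  have hl := Real.hasDerivAt_log hx.ne'
  have h := (((hl.fun_pow 2).fun_add (hl.const_mul 2)).add_const 2).fun_div (hasDerivAt_id' x)
    hx.ne'
  refine h.congr_deriv ?_
  norm_num
  field_simp
  ring

/-- `F₃' = -g₃` (`x > 0`). [folklore] -/
theorem hasDerivAt_F3 {x : ℝ} (hx : 0 < x) : HasDerivAt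
    (fun y ↦ ((Real.log y ^ 3 + 3 * Real.log y ^ 2 + 6 * Real.log y + 6) / y))
    (-(Real.log x ^ 3 / x ^ 2)) x := by
  have hl := Real.hasDerivAt_log hx.ne'
  have h := ((((hl.fun_pow 3).fun_add ((hl.fun_pow 2).const_mul 3)).fun_add
    (hl.const_mul 6)).add_const 6).fun_div (hasDerivAt_id' x) hx.ne'
  refine h.congr_deriv ?_
  norm_num
  field_simp
  ring

/-- `∂ₓΦ₁(m, x) = (x - m) g₁(x)` (`x > 0`). [folklore] -/
theorem hasDerivAt_Phi1 (m : ℝ) {x : ℝ} (hx : 0 < x) :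
    HasDerivAt (fun y ↦ (Real.log y ^ 2 / 2 + m * ((Real.log y + 1) / y)))
        ((x - m) * (Real.log x ^ 1 / x ^ 2)) x := by
  have hl := Real.hasDerivAt_log hx.ne'
  have h := ((hl.fun_pow 2).div_const 2).fun_add ((hasDerivAt_F1 hx).const_mul m)
  refine h.congr_deriv ?_
  norm_num
  field_simp
  ring

/-- `∂ₓΦ₂(m, x) = (x - m) g₂(x)` (`x > 0`). [folklore] -/
theorem hasDerivAt_Phi2 (m : ℝ) {x : ℝ} (hx : 0 < x) :
    HasDerivAt (fun y ↦ (Real.log y ^ 3 / 3 + m * ((Real.log y ^ 2 + 2 * Real.log y + 2) / y)))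
        ((x - m) * (Real.log x ^ 2 / x ^ 2)) x := by
  have hl := Real.hasDerivAt_log hx.ne'
  have h := ((hl.fun_pow 3).div_const 3).fun_add ((hasDerivAt_F2 hx).const_mul m)
  refine h.congr_deriv ?_
  norm_num
  field_simp
  ring

/-- `∂ₓΦ₃(m, x) = (x - m) g₃(x)` (`x > 0`). [folklore] -/
theorem hasDerivAt_Phi3 (m : ℝ) {x : ℝ} (hx : 0 < x) :
    HasDerivAt (fun y ↦ (Real.log y ^ 4 / 4 + m * ((Real.log y ^ 3 + 3 * Real.log y ^ 2 + 6 *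
        Real.log y + 6) / y))) ((x - m) * (Real.log x ^ 3 / x ^ 2)) x := by
  have hl := Real.hasDerivAt_log hx.ne'
  have h := ((hl.fun_pow 4).div_const 4).fun_add ((hasDerivAt_F3 hx).const_mul m)
  refine h.congr_deriv ?_
  norm_num
  field_simp
  ring

/-- Continuity of `g_k` on `[p, q]`, `p > 0`. [folklore] -/
theorem continuousOn_gk (k : ℕ) {p q : ℝ} (hp : 0 < p) : ContinuousOn
    (fun y ↦ (Real.log y ^ k / y ^ 2)) (Icc p q) := by
  refine ContinuousOn.div ((Real.continuousOn_log.mono ?_).pow k) (continuousOn_id.pow 2) ?_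
  · intro x hx
    exact Set.mem_compl_singleton_iff.mpr (hp.trans_le hx.1).ne'
  · intro x hx
    exact pow_ne_zero 2 (hp.trans_le hx.1).ne'

/-- Continuity of `(x - m) g_k(x)` on `[p, q]`, `p > 0`. [folklore] -/
theorem continuousOn_mul_gk (k : ℕ) (m : ℝ) {p q : ℝ} (hp : 0 < p) :
    ContinuousOn (fun x ↦ (x - m) * (Real.log x ^ k / x ^ 2)) (Icc p q) :=
  (continuousOn_id.sub continuousOn_const).mul (continuousOn_gk k hp)

/-- FTC on `[p, q] ⊂ (0, ∞)`. [folklore] -/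
theorem integral_eq_of_hasDerivAt_pos {F f : ℝ → ℝ} {p q : ℝ} (hp : 0 < p) (hpq : p ≤ q)
    (hderiv : ∀ x, 0 < x → HasDerivAt F (f x) x) (hcont : ContinuousOn f (Icc p q)) :
    ∫ x in p..q, f x = F q - F p := by
  refine intervalIntegral.integral_eq_sub_of_hasDerivAt (fun x hx ↦ hderiv x ?_)
    (ContinuousOn.intervalIntegrable_of_Icc hpq hcont)
  rw [uIcc_of_le hpq] at hx
  exact hp.trans_le hx.1

/-- `∫_p^q g₁ = F₁(p) - F₁(q)` (`0 < p ≤ q`). [folklore] -/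
theorem integral_gk1 {p q : ℝ} (hp : 0 < p) (hpq : p ≤ q) : ∫ x in p..q, (Real.log x ^ 1 / x ^ 2) =
    ((Real.log p + 1) / p) - ((Real.log q + 1) / q) := by
  have h := integral_eq_of_hasDerivAt_pos (F := fun x ↦ -((Real.log x + 1) / x))
      (f := fun y ↦ (Real.log y ^ 1 / y ^ 2)) hp hpq
    (fun x hx ↦ ((hasDerivAt_F1 hx).fun_neg).congr_deriv (neg_neg _)) (continuousOn_gk 1 hp)
  rw [h]; ring

/-- `∫_p^q g₂ = F₂(p) - F₂(q)` (`0 < p ≤ q`). [folklore] -/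
theorem integral_gk2 {p q : ℝ} (hp : 0 < p) (hpq : p ≤ q) : ∫ x in p..q, (Real.log x ^ 2 / x ^ 2) =
    ((Real.log p ^ 2 + 2 * Real.log p + 2) / p) - ((Real.log q ^ 2 + 2 * Real.log q + 2) / q) := by
  have h := integral_eq_of_hasDerivAt_pos (F := fun x ↦
      -((Real.log x ^ 2 + 2 * Real.log x + 2) / x)) (f := fun y ↦ (Real.log y ^ 2 / y ^ 2)) hp hpq
    (fun x hx ↦ ((hasDerivAt_F2 hx).fun_neg).congr_deriv (neg_neg _)) (continuousOn_gk 2 hp)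
  rw [h]; ring

/-- `∫_p^q g₃ = F₃(p) - F₃(q)` (`0 < p ≤ q`). [folklore] -/
theorem integral_gk3 {p q : ℝ} (hp : 0 < p) (hpq : p ≤ q) : ∫ x in p..q, (Real.log x ^ 3 / x ^ 2) =
    ((Real.log p ^ 3 + 3 * Real.log p ^ 2 + 6 * Real.log p + 6) / p) -
    ((Real.log q ^ 3 + 3 * Real.log q ^ 2 + 6 * Real.log q + 6) / q) := by
  have h := integral_eq_of_hasDerivAt_pos (F := fun x ↦
      -((Real.log x ^ 3 + 3 * Real.log x ^ 2 + 6 * Real.log x + 6) / x))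
      (f := fun y ↦ (Real.log y ^ 3 / y ^ 2)) hp hpq
    (fun x hx ↦ ((hasDerivAt_F3 hx).fun_neg).congr_deriv (neg_neg _)) (continuousOn_gk 3 hp)
  rw [h]; ring

/-- `∫_m^{m+1} (x - m) g₁ = Φ₁(m, m+1) - Φ₁(m, m)` (`m > 0`). [folklore] -/
theorem integral_mul_gk1 {m : ℝ} (hm : 0 < m) :
    ∫ x in m..m + 1, (x - m) * (Real.log x ^ 1 / x ^ 2) =
        (Real.log (m + 1) ^ 2 / 2 + m * ((Real.log (m + 1) + 1) / (m + 1))) -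
        (Real.log m ^ 2 / 2 + m * ((Real.log m + 1) / m)) :=
  integral_eq_of_hasDerivAt_pos hm (by linarith) (fun _ hx ↦ hasDerivAt_Phi1 m hx)
    (continuousOn_mul_gk 1 m hm)

/-- `∫_m^{m+1} (x - m) g₂ = Φ₂(m, m+1) - Φ₂(m, m)` (`m > 0`). [folklore] -/
theorem integral_mul_gk2 {m : ℝ} (hm : 0 < m) :
    ∫ x in m..m + 1, (x - m) * (Real.log x ^ 2 / x ^ 2) =
        (Real.log (m + 1) ^ 3 / 3 + m * ((Real.log (m + 1) ^ 2 + 2 * Real.log (m + 1) + 2) /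
        (m + 1))) - (Real.log m ^ 3 / 3 + m * ((Real.log m ^ 2 + 2 * Real.log m + 2) / m)) :=
  integral_eq_of_hasDerivAt_pos hm (by linarith) (fun _ hx ↦ hasDerivAt_Phi2 m hx)
    (continuousOn_mul_gk 2 m hm)

/-- `∫_m^{m+1} (x - m) g₃ = Φ₃(m, m+1) - Φ₃(m, m)` (`m > 0`). [folklore] -/
theorem integral_mul_gk3 {m : ℝ} (hm : 0 < m) :
    ∫ x in m..m + 1, (x - m) * (Real.log x ^ 3 / x ^ 2) =
        (Real.log (m + 1) ^ 4 / 4 + m * ((Real.log (m + 1) ^ 3 + 3 * Real.log (m + 1) ^ 2 + 6 *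
        Real.log (m + 1) + 6) / (m + 1))) - (Real.log m ^ 4 / 4 + m *
        ((Real.log m ^ 3 + 3 * Real.log m ^ 2 + 6 * Real.log m + 6) / m)) :=
  integral_eq_of_hasDerivAt_pos hm (by linarith) (fun _ hx ↦ hasDerivAt_Phi3 m hx)
    (continuousOn_mul_gk 3 m hm)

/-- `g_{j+1}` is antitone on `[a, ∞)` once `log a ≥ (j+1)/2` (`a > 0`). [folklore] -/
theorem antitoneOn_gk (j : ℕ) {a : ℝ} (ha : 0 < a) (hlog : ((j : ℝ) + 1) / 2 ≤ Real.log a) :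
    AntitoneOn (fun y ↦ (Real.log y ^ (j + 1) / y ^ 2)) (Ici a) := by
  have hderiv : ∀ x, 0 < x → HasDerivAt (fun y ↦ (Real.log y ^ (j + 1) / y ^ 2))
      (Real.log x ^ j * (((j : ℝ) + 1) - 2 * Real.log x) / x ^ 3) x := by
    intro x hx
    have h := ((Real.hasDerivAt_log hx.ne').fun_pow (j + 1)).fun_div (hasDerivAt_pow 2 x)
      (pow_ne_zero 2 hx.ne')
    refine h.congr_deriv ?_
    push_cast
    (try norm_num)
    field_simp
    ring
  refine antitoneOn_of_deriv_nonpos (convex_Ici a)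
    (fun x hx ↦ (hderiv x (ha.trans_le hx)).continuousAt.continuousWithinAt)
    (fun x hx ↦ (hderiv x (ha.trans_le (interior_subset hx))).differentiableAt
      |>.differentiableWithinAt) ?_
  intro x hx
  rw [interior_Ici] at hx
  have hx0 : 0 < x := ha.trans hx
  rw [(hderiv x hx0).deriv]
  apply div_nonpos_of_nonpos_of_nonneg _ (by positivity)
  have hlx : ((j : ℝ) + 1) / 2 ≤ Real.log x := hlog.trans (Real.log_le_log ha hx.le)
  have hl0 : 0 ≤ Real.log x := le_trans (by positivity) hlx
  apply mul_nonpos_of_nonneg_of_nonpos (by positivity)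
  linarith

/-- The global maximum of `g₃`: `log³ x/x² ≤ 27/(8e³) < 0.16804` (`x > 0`). [folklore] -/
theorem gk_three_le {x : ℝ} (hx : 0 < x) : (Real.log x ^ 3 / x ^ 2) ≤ 0.16804 := by
  rcases lt_or_ge (Real.log x) 0 with hneg | hpos
  · have : Real.log x ^ 3 / x ^ 2 ≤ 0 :=
      div_nonpos_of_nonpos_of_nonneg (by nlinarith [sq_nonneg (Real.log x)]) (by positivity)
    linarith
  set t := Real.log x with ht
  have hxexp : x ^ 2 = Real.exp (2 * t) := by
    have : Real.exp (2 * t) = Real.exp t ^ 2 := by rw [← Real.exp_nat_mul]; norm_num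
    rw [this, ht, Real.exp_log hx]
  have h1 : 2 * t / 3 ≤ Real.exp (2 * t / 3 - 1) := by
    have := Real.add_one_le_exp (2 * t / 3 - 1); linarith
  have h2 : (2 * t / 3) ^ 3 ≤ Real.exp (2 * t / 3 - 1) ^ 3 := pow_le_pow_left₀ (by positivity) h1 3
  have h3 : Real.exp (2 * t / 3 - 1) ^ 3 = Real.exp (2 * t) / Real.exp 3 := by
    rw [← Real.exp_nat_mul, ← Real.exp_sub]; congr 1; push_cast; ring
  rw [h3] at h2
  have he : (2.7182818283 : ℝ) < Real.exp 1 := Real.exp_one_gt_d9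
  have he3 : (20.0855 : ℝ) < Real.exp 3 := by
    have e3 : Real.exp 3 = Real.exp 1 ^ 3 := by rw [← Real.exp_nat_mul]; norm_num
    have := pow_lt_pow_left₀ he (by norm_num) (by norm_num : (3:ℕ) ≠ 0)
    rw [e3]; linarith [show (20.0855:ℝ) < 2.7182818283 ^ 3 by norm_num]
  have hE : 0 < Real.exp (2 * t) := Real.exp_pos _
  rw [hxexp, div_le_iff₀ hE]
  rw [le_div_iff₀ (Real.exp_pos 3)] at h2
  have ht3 : 0 ≤ t ^ 3 := by positivity
  have key : 8 / 27 * t ^ 3 * 20.0855 ≤ Real.exp (2 * t) := by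
    have := mul_le_mul_of_nonneg_left he3.le (by positivity : (0:ℝ) ≤ 8 / 27 * t ^ 3)
    nlinarith
  nlinarith

/-! #### Chebyshev-type estimates for `∫_m^{m+1} (x-m) g(x) dx`, `g` antitone -/

/-- `∫_m^{m+1} (x - m - 1/2) dx = 0`. [folklore] -/
theorem integral_linear_zero (m : ℝ) : ∫ x in m..m + 1, (x - m - 1 / 2) = 0 := by
  have h : ∀ x ∈ uIcc m (m + 1),
      HasDerivAt (fun x ↦ (x - m - 1 / 2) * (x - m - 1 / 2) / 2) (x - m - 1 / 2) x := by
    intro x _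
    have h1 := ((hasDerivAt_id' x).sub_const m).sub_const (1 / 2 : ℝ)
    exact ((h1.fun_mul h1).div_const 2).congr_deriv (by ring)
  rw [intervalIntegral.integral_eq_sub_of_hasDerivAt h
    ((by fun_prop : Continuous fun x : ℝ ↦ x - m - 1 / 2).intervalIntegrable _ _)]
  ring

/-- `∫_m^{m+1} (x - m)²/2 dx = 1/6`. [folklore] -/
theorem integral_sq_half (m : ℝ) : ∫ x in m..m + 1, (x - m) ^ 2 / 2 = 1 / 6 := by
  have h : ∀ x ∈ uIcc m (m + 1),
      HasDerivAt (fun x ↦ (x - m) * (x - m) * (x - m) / 6) ((x - m) ^ 2 / 2) x := by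
    intro x _
    have h1 := (hasDerivAt_id' x).sub_const m
    exact (((h1.fun_mul h1).fun_mul h1).div_const 6).congr_deriv (by ring)
  rw [intervalIntegral.integral_eq_sub_of_hasDerivAt h
    ((by fun_prop : Continuous fun x : ℝ ↦ (x - m) ^ 2 / 2).intervalIntegrable _ _)]
  ring

/-- `∫_m^{m+1} (x - m) dx = 1/2`. [folklore] -/
theorem integral_sub_self (m : ℝ) : ∫ x in m..m + 1, (x - m) = 1 / 2 := by
  have h : ∀ x ∈ uIcc m (m + 1),
      HasDerivAt (fun x ↦ (x - m) * (x - m) / 2) (x - m) x := by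
    intro x _
    have h1 := (hasDerivAt_id' x).sub_const m
    exact ((h1.fun_mul h1).div_const 2).congr_deriv (by ring)
  rw [intervalIntegral.integral_eq_sub_of_hasDerivAt h
    ((by fun_prop : Continuous fun x : ℝ ↦ x - m).intervalIntegrable _ _)]
  ring

/-- Upper Chebyshev estimate: for `g` antitone (and continuous) on `[m, m+1]`,
`∫_m^{m+1} (x-m) g ≤ ½ ∫_m^{m+1} g`. [folklore] -/
theorem integral_mul_le_half {g : ℝ → ℝ} {m : ℝ} (hg : ContinuousOn g (Icc m (m + 1)))
    (hanti : AntitoneOn g (Icc m (m + 1))) :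
    ∫ x in m..m + 1, (x - m) * g x ≤ 1 / 2 * ∫ x in m..m + 1, g x := by
  have hm1 : m ≤ m + 1 := by linarith
  have hmid : m + 1 / 2 ∈ Icc m (m + 1) := ⟨by linarith, by linarith⟩
  have hpt : ∀ x ∈ Icc m (m + 1),
      (x - m) * g x ≤ (x - m - 1 / 2) * g (m + 1 / 2) + 1 / 2 * g x := by
    intro x hx
    rcases le_total x (m + 1 / 2) with hle | hle
    · have := hanti hx hmid hle
      nlinarith
    · have := hanti hmid hx hle
      nlinarith
  have iL : IntervalIntegrable (fun x ↦ (x - m) * g x) volume m (m + 1) :=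
    ContinuousOn.intervalIntegrable_of_Icc hm1 ((continuousOn_id.sub continuousOn_const).mul hg)
  have i1 : IntervalIntegrable (fun x ↦ (x - m - 1 / 2) * g (m + 1 / 2)) volume m (m + 1) :=
    (by fun_prop : Continuous fun x : ℝ ↦ (x - m - 1 / 2) * g (m + 1 / 2)).intervalIntegrable _ _
  have i2 : IntervalIntegrable (fun x ↦ 1 / 2 * g x) volume m (m + 1) :=
    (ContinuousOn.intervalIntegrable_of_Icc hm1 hg).const_mul _
  have hmono := intervalIntegral.integral_mono_on hm1 iL (i1.add i2) hpt
  rw [intervalIntegral.integral_add i1 i2, intervalIntegral.integral_mul_const,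
    integral_linear_zero, intervalIntegral.integral_const_mul] at hmono
  linarith

/-- Lower Chebyshev estimate: for `g` antitone (and continuous) on `[m, m+1]`,
`∫_m^{m+1} (x-m) g ≥ ½ ∫_m^{m+1} g - (g(m) - g(m+1))/6`. [folklore] -/
theorem integral_mul_ge {g : ℝ → ℝ} {m : ℝ} (hg : ContinuousOn g (Icc m (m + 1)))
    (hanti : AntitoneOn g (Icc m (m + 1))) :
    1 / 2 * (∫ x in m..m + 1, g x) - (g m - g (m + 1)) / 6 ≤ ∫ x in m..m + 1, (x - m) * g x := by
  have hm1 : m ≤ m + 1 := by linarith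
  have hmI : m ∈ Icc m (m + 1) := ⟨le_rfl, hm1⟩
  have hm1I : m + 1 ∈ Icc m (m + 1) := ⟨hm1, le_rfl⟩
  have hD : 0 ≤ g m - g (m + 1) := by linarith [hanti hmI hm1I hm1]
  have hpt : ∀ x ∈ Icc m (m + 1),
      (x - m - 1 / 2) * g m - (x - m) ^ 2 / 2 * (g m - g (m + 1)) + 1 / 2 * g x
        ≤ (x - m) * g x := by
    intro x hx
    have hxm : g x ≤ g m := hanti hmI hx hx.1
    have hxm1 : g (m + 1) ≤ g x := hanti hx hm1I hx.2
    rcases le_total x (m + 1 / 2) with hle | hle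
    · have h1 : (x - m - 1 / 2) * (g m - g x) ≤ 0 :=
        mul_nonpos_of_nonpos_of_nonneg (by linarith) (by linarith)
      have h2 : 0 ≤ (x - m) ^ 2 / 2 * (g m - g (m + 1)) := by positivity
      nlinarith
    · have h1 : (x - m - 1 / 2) * (g m - g x) ≤ (x - m - 1 / 2) * (g m - g (m + 1)) :=
        mul_le_mul_of_nonneg_left (by linarith) (by linarith)
      have h2 : (x - m - 1 / 2) * (g m - g (m + 1)) ≤ (x - m) ^ 2 / 2 * (g m - g (m + 1)) :=
        mul_le_mul_of_nonneg_right (by nlinarith [sq_nonneg (x - m - 1)]) hD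
      nlinarith
  have iR : IntervalIntegrable (fun x ↦ (x - m) * g x) volume m (m + 1) :=
    ContinuousOn.intervalIntegrable_of_Icc hm1 ((continuousOn_id.sub continuousOn_const).mul hg)
  have i1 : IntervalIntegrable (fun x ↦ (x - m - 1 / 2) * g m) volume m (m + 1) :=
    (by fun_prop : Continuous fun x : ℝ ↦ (x - m - 1 / 2) * g m).intervalIntegrable _ _
  have i2 : IntervalIntegrable (fun x ↦ (x - m) ^ 2 / 2 * (g m - g (m + 1))) volume m (m + 1) :=
    (by fun_prop : Continuous fun x : ℝ ↦ (x - m) ^ 2 / 2 * (g m - g (m + 1))).intervalIntegrable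
      _ _
  have i3 : IntervalIntegrable (fun x ↦ 1 / 2 * g x) volume m (m + 1) :=
    (ContinuousOn.intervalIntegrable_of_Icc hm1 hg).const_mul _
  have hmono := intervalIntegral.integral_mono_on hm1 ((i1.sub i2).add i3) iR hpt
  rw [intervalIntegral.integral_add (i1.sub i2) i3, intervalIntegral.integral_sub i1 i2,
    intervalIntegral.integral_mul_const, intervalIntegral.integral_mul_const,
    integral_linear_zero, integral_sq_half, intervalIntegral.integral_const_mul] at hmono
  linarith

/-- Crude estimate: `g ≤ M` on `[m, m+1]` gives `∫_m^{m+1} (x-m) g ≤ M/2`. [folklore] -/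
theorem integral_mul_le_of_le {g : ℝ → ℝ} {m M : ℝ} (hg : ContinuousOn g (Icc m (m + 1)))
    (hM : ∀ x ∈ Icc m (m + 1), g x ≤ M) : ∫ x in m..m + 1, (x - m) * g x ≤ M / 2 := by
  have hm1 : m ≤ m + 1 := by linarith
  have hpt : ∀ x ∈ Icc m (m + 1), (x - m) * g x ≤ (x - m) * M := fun x hx ↦
    mul_le_mul_of_nonneg_left (hM x hx) (by linarith [hx.1])
  have iL : IntervalIntegrable (fun x ↦ (x - m) * g x) volume m (m + 1) :=
    ContinuousOn.intervalIntegrable_of_Icc hm1 ((continuousOn_id.sub continuousOn_const).mul hg)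
  have iR : IntervalIntegrable (fun x ↦ (x - m) * M) volume m (m + 1) :=
    (by fun_prop : Continuous fun x : ℝ ↦ (x - m) * M).intervalIntegrable _ _
  have hmono := intervalIntegral.integral_mono_on hm1 iL iR hpt
  rw [intervalIntegral.integral_mul_const, integral_sub_self] at hmono
  linarith

/-! #### Termwise Taylor bound and summation -/

/-- `A_k(m) ≥ 0` for `m ≥ 1` (non-negative integrand). [folklore] -/
theorem Ak_nonneg (k : ℕ) {m : ℕ} (hm : 1 ≤ m) : 0 ≤ (∫ t in ((m : ℕ) : ℝ)..((m : ℕ) : ℝ) + 1,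
    (t - ((m : ℕ) : ℝ)) * (Real.log t ^ k / t ^ 2)) := by
  refine intervalIntegral.integral_nonneg (by linarith) fun x hx ↦ ?_
  have hx1 : (1:ℝ) ≤ x := le_trans (by exact_mod_cast hm) hx.1
  have : 0 ≤ (Real.log x ^ k / x ^ 2) := div_nonneg (pow_nonneg (Real.log_nonneg hx1) k)
      (by positivity)
  exact mul_nonneg (by linarith [hx.1]) this

/-- The termwise Taylor bound: for `n ≥ 1`, `u ≥ 0`,
`term n (1+u) ≥ term n 1 - u A₁(n) + (u²/2) A₂(n) - (u³/6) A₃(n)`, from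
`x^{-u} = e^{-u log x} ≥ 1 - uℓ + u²ℓ²/2 - u³ℓ³/6` (`ℓ = log x ≥ 0`). [folklore] -/
theorem term_ge_taylor {n : ℕ} (hn : 0 < n) {u : ℝ} (hu : 0 ≤ u) :
    term n 1 - u * (∫ t in ((n : ℕ) : ℝ)..((n : ℕ) : ℝ) + 1, (t - ((n : ℕ) : ℝ)) *
        (Real.log t ^ 1 / t ^ 2)) + u ^ 2 / 2 * (∫ t in ((n : ℕ) : ℝ)..((n : ℕ) : ℝ) + 1,
        (t - ((n : ℕ) : ℝ)) * (Real.log t ^ 2 / t ^ 2)) - u ^ 3 / 6 *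
        (∫ t in ((n : ℕ) : ℝ)..((n : ℕ) : ℝ) + 1, (t - ((n : ℕ) : ℝ)) * (Real.log t ^ 3 / t ^ 2)) ≤
        term n (1 + u) := by
  have hn' : (0:ℝ) < n := by exact_mod_cast hn
  have hnn : (n:ℝ) ≤ n + 1 := by linarith
  -- integrability
  have i0 : IntervalIntegrable (fun x : ℝ ↦ (x - n) / x ^ ((1:ℝ) + 1)) volume n (n + 1) :=
    term_welldef hn one_pos
  have iu : IntervalIntegrable (fun x : ℝ ↦ (x - n) / x ^ ((1 + u) + 1)) volume n (n + 1) :=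
    term_welldef hn (by linarith)
  have i1 : IntervalIntegrable (fun x : ℝ ↦ (x - n) * (Real.log x ^ 1 / x ^ 2)) volume n (n + 1) :=
    ContinuousOn.intervalIntegrable_of_Icc hnn (continuousOn_mul_gk 1 n hn')
  have i2 : IntervalIntegrable (fun x : ℝ ↦ (x - n) * (Real.log x ^ 2 / x ^ 2)) volume n (n + 1) :=
    ContinuousOn.intervalIntegrable_of_Icc hnn (continuousOn_mul_gk 2 n hn')
  have i3 : IntervalIntegrable (fun x : ℝ ↦ (x - n) * (Real.log x ^ 3 / x ^ 2)) volume n (n + 1) :=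
    ContinuousOn.intervalIntegrable_of_Icc hnn (continuousOn_mul_gk 3 n hn')
  -- pointwise
  have hpt : ∀ x ∈ Icc (n:ℝ) (n + 1),
      (x - n) / x ^ ((1:ℝ) + 1) - u * ((x - n) * (Real.log x ^ 1 / x ^ 2)) + u ^ 2 / 2 *
          ((x - n) * (Real.log x ^ 2 / x ^ 2))
        - u ^ 3 / 6 * ((x - n) * (Real.log x ^ 3 / x ^ 2)) ≤ (x - n) / x ^ ((1 + u) + 1) := by
    intro x hx
    have hx1 : (1:ℝ) ≤ x := le_trans (by exact_mod_cast hn) hx.1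
    have hx0 : 0 < x := by linarith
    have hl : 0 ≤ Real.log x := Real.log_nonneg hx1
    have e1 : x ^ ((1:ℝ) + 1) = x ^ 2 := by norm_num
    have e2 : x ^ ((1 + u) + 1) = x ^ 2 * Real.exp (u * Real.log x) := by
      rw [show (1 + u) + 1 = 2 + u by ring, Real.rpow_add hx0, Real.rpow_two,
        Real.rpow_def_of_pos hx0, mul_comm (Real.log x)]
    have hT := cubic_le_exp_neg (v := u * Real.log x) (by positivity)
    have hfac : 0 ≤ (x - n) / x ^ 2 := div_nonneg (by linarith [hx.1]) (by positivity)
    have key : (x - n) / x ^ 2 * (1 - u * Real.log x + (u * Real.log x) ^ 2 / 2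
        - (u * Real.log x) ^ 3 / 6) ≤ (x - n) / x ^ 2 * Real.exp (-(u * Real.log x)) :=
      mul_le_mul_of_nonneg_left hT hfac
    have lhs : (x - n) / x ^ ((1:ℝ) + 1) - u * ((x - n) * (Real.log x ^ 1 / x ^ 2)) + u ^ 2 / 2 *
        ((x - n) * (Real.log x ^ 2 / x ^ 2))
        - u ^ 3 / 6 * ((x - n) * (Real.log x ^ 3 / x ^ 2)) = (x - n) / x ^ 2 * (1 - u * Real.log x
          + (u * Real.log x) ^ 2 / 2 - (u * Real.log x) ^ 3 / 6) := by
      rw [e1]; ring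
    have rhs : (x - n) / x ^ ((1 + u) + 1) = (x - n) / x ^ 2 * Real.exp (-(u * Real.log x)) := by
      rw [e2, Real.exp_neg]; field_simp
    rw [lhs, rhs]
    exact key
  have hmono := intervalIntegral.integral_mono_on hnn
    (((i0.sub (i1.const_mul u)).add (i2.const_mul (u ^ 2 / 2))).sub (i3.const_mul (u ^ 3 / 6)))
    iu hpt
  rw [intervalIntegral.integral_sub ((i0.sub (i1.const_mul u)).add (i2.const_mul (u ^ 2 / 2)))
      (i3.const_mul (u ^ 3 / 6)),
    intervalIntegral.integral_add (i0.sub (i1.const_mul u)) (i2.const_mul (u ^ 2 / 2)),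
    intervalIntegral.integral_sub i0 (i1.const_mul u), intervalIntegral.integral_const_mul,
    intervalIntegral.integral_const_mul, intervalIntegral.integral_const_mul] at hmono
  simpa only [term] using hmono

/-! #### Antitonicity ranges and the three tails -/

/-- `log 6 = log 2 + log 3`. [folklore] -/
theorem log_six_eq : Real.log 6 = Real.log 2 + Real.log 3 := by
  rw [show (6:ℝ) = 2 * 3 by norm_num, Real.log_mul (by norm_num) (by norm_num)]

/-- `g₁ = log x/x²` is antitone on `[4, ∞)` (indeed from `√e` on). [folklore] -/
theorem antitoneOn_gk1 : AntitoneOn (fun y ↦ (Real.log y ^ 1 / y ^ 2)) (Ici 4) := by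
  refine antitoneOn_gk 0 (by norm_num) ?_
  rw [show (4:ℝ) = 2 ^ 2 by norm_num, Real.log_pow]
  have := Real.log_two_gt_d9; norm_num; linarith

/-- `g₂ = log² x/x²` is antitone on `[3, ∞)` (indeed from `e` on). [folklore] -/
theorem antitoneOn_gk2 : AntitoneOn (fun y ↦ (Real.log y ^ 2 / y ^ 2)) (Ici 3) := by
  refine antitoneOn_gk 1 (by norm_num) ?_
  have := Real.log_three_gt_d9; norm_num; linarith

/-- `g₃ = log³ x/x²` is antitone on `[6, ∞)` (indeed from `e^{3/2}` on). [folklore] -/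
theorem antitoneOn_gk3 : AntitoneOn (fun y ↦ (Real.log y ^ 3 / y ^ 2)) (Ici 6) := by
  refine antitoneOn_gk 2 (by norm_num) ?_
  rw [log_six_eq]; have := Real.log_two_gt_d9; have := Real.log_three_gt_d9; norm_num; linarith

/-- `F₁, F₂, F₃ ≥ 0` on `[1, ∞)`. [folklore] -/
theorem Fk_nonneg_aux {x : ℝ} (hx : 1 ≤ x) : 0 ≤ ((Real.log x + 1) / x) ∧ 0 ≤
    ((Real.log x ^ 2 + 2 * Real.log x + 2) / x) ∧ 0 ≤ ((Real.log x ^ 3 + 3 * Real.log x ^ 2 + 6 *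
    Real.log x + 6) / x) := by
  have hl : 0 ≤ Real.log x := Real.log_nonneg hx
  have hx0 : 0 < x := by linarith
  refine ⟨div_nonneg (by positivity) hx0.le, div_nonneg (by positivity) hx0.le,
    div_nonneg (by positivity) hx0.le⟩

/-- Tail term for `J₁`: `A₁(m+1) ≤ (F₁(m+1) - F₁(m+2))/2` for `m ≥ 3`. [folklore] -/
theorem Ak1_tail {m : ℕ} (hm : 3 ≤ m) : (∫ t in ((m + 1 : ℕ) : ℝ)..((m + 1 : ℕ) : ℝ) + 1,
    (t - ((m + 1 : ℕ) : ℝ)) * (Real.log t ^ 1 / t ^ 2)) ≤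
    (((Real.log (m + 1) + 1) / (m + 1)) - ((Real.log (m + 2) + 1) / (m + 2))) / 2 := by
  have hm' : (4:ℝ) ≤ (m:ℝ) + 1 := by exact_mod_cast Nat.succ_le_succ hm
  have hp : (0:ℝ) < (m:ℝ) + 1 := by linarith
  have hanti : AntitoneOn (fun y ↦ (Real.log y ^ 1 / y ^ 2)) (Icc ((m:ℝ) + 1) ((m:ℝ) + 1 + 1)) :=
    antitoneOn_gk1.mono fun x hx ↦ le_trans hm' hx.1
  have h := integral_mul_le_half (continuousOn_gk 1 hp) hanti
  rw [integral_gk1 hp (by linarith)] at h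
  push_cast
  rw [show (m:ℝ) + 2 = (m:ℝ) + 1 + 1 by ring]
  linarith

/-- Tail terms for `J₂`: two-sided, for `m ≥ 2`. [folklore] -/
theorem Ak2_tail {m : ℕ} (hm : 2 ≤ m) :
    (∫ t in ((m + 1 : ℕ) : ℝ)..((m + 1 : ℕ) : ℝ) + 1, (t - ((m + 1 : ℕ) : ℝ)) *
        (Real.log t ^ 2 / t ^ 2)) ≤ (((Real.log (m + 1) ^ 2 + 2 * Real.log (m + 1) + 2) / (m + 1))
        - ((Real.log (m + 2) ^ 2 + 2 * Real.log (m + 2) + 2) / (m + 2))) / 2 ∧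
    (((Real.log (m + 1) ^ 2 + 2 * Real.log (m + 1) + 2) / (m + 1)) -
        ((Real.log (m + 2) ^ 2 + 2 * Real.log (m + 2) + 2) / (m + 2))) / 2 -
        ((Real.log (m + 1) ^ 2 / (m + 1) ^ 2) - (Real.log (m + 2) ^ 2 / (m + 2) ^ 2)) / 6 ≤
        (∫ t in ((m + 1 : ℕ) : ℝ)..((m + 1 : ℕ) : ℝ) + 1, (t - ((m + 1 : ℕ) : ℝ)) *
        (Real.log t ^ 2 / t ^ 2)) := by
  have hm' : (3:ℝ) ≤ (m:ℝ) + 1 := by exact_mod_cast Nat.succ_le_succ hm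
  have hp : (0:ℝ) < (m:ℝ) + 1 := by linarith
  have hanti : AntitoneOn (fun y ↦ (Real.log y ^ 2 / y ^ 2)) (Icc ((m:ℝ) + 1) ((m:ℝ) + 1 + 1)) :=
    antitoneOn_gk2.mono fun x hx ↦ le_trans hm' hx.1
  have h := integral_mul_le_half (continuousOn_gk 2 hp) hanti
  have h' := integral_mul_ge (continuousOn_gk 2 hp) hanti
  rw [integral_gk2 hp (by linarith)] at h h'
  push_cast
  rw [show (m:ℝ) + 2 = (m:ℝ) + 1 + 1 by ring]
  exact ⟨by linarith, by linarith⟩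

/-- Tail term for `J₃`: `A₃(m+1) ≤ (F₃(m+1) - F₃(m+2))/2` for `m ≥ 5`. [folklore] -/
theorem Ak3_tail {m : ℕ} (hm : 5 ≤ m) : (∫ t in ((m + 1 : ℕ) : ℝ)..((m + 1 : ℕ) : ℝ) + 1,
    (t - ((m + 1 : ℕ) : ℝ)) * (Real.log t ^ 3 / t ^ 2)) ≤
    (((Real.log (m + 1) ^ 3 + 3 * Real.log (m + 1) ^ 2 + 6 * Real.log (m + 1) + 6) / (m + 1)) -
    ((Real.log (m + 2) ^ 3 + 3 * Real.log (m + 2) ^ 2 + 6 * Real.log (m + 2) + 6) / (m + 2))) / 2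
    := by
  have hm' : (6:ℝ) ≤ (m:ℝ) + 1 := by exact_mod_cast Nat.succ_le_succ hm
  have hp : (0:ℝ) < (m:ℝ) + 1 := by linarith
  have hanti : AntitoneOn (fun y ↦ (Real.log y ^ 3 / y ^ 2)) (Icc ((m:ℝ) + 1) ((m:ℝ) + 1 + 1)) :=
    antitoneOn_gk3.mono fun x hx ↦ le_trans hm' hx.1
  have h := integral_mul_le_half (continuousOn_gk 3 hp) hanti
  rw [integral_gk3 hp (by linarith)] at h
  push_cast
  rw [show (m:ℝ) + 2 = (m:ℝ) + 1 + 1 by ring]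
  linarith

/-- Crude bound for the first intervals of `J₃`: `A₃(m) ≤ 0.08402`. [folklore] -/
theorem Ak3_crude {m : ℕ} (hm : 1 ≤ m) : (∫ t in ((m : ℕ) : ℝ)..((m : ℕ) : ℝ) + 1,
    (t - ((m : ℕ) : ℝ)) * (Real.log t ^ 3 / t ^ 2)) ≤ 0.16804 / 2 := by
  have hp : (0:ℝ) < (m:ℝ) := by exact_mod_cast hm
  exact integral_mul_le_of_le (continuousOn_gk 3 hp) fun x hx ↦ gk_three_le (hp.trans_le hx.1)

/-! #### Partial sums, summability and the bounds on `J₁, J₂, J₃` -/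

/-- The exact first values. [folklore] -/
theorem Ak_one_vals : (∫ t in ((1 : ℕ) : ℝ)..((1 : ℕ) : ℝ) + 1, (t - ((1 : ℕ) : ℝ)) *
    (Real.log t ^ 1 / t ^ 2)) = (Real.log 2 ^ 2 / 2 + 1 * ((Real.log 2 + 1) / 2)) -
    (Real.log 1 ^ 2 / 2 + 1 * ((Real.log 1 + 1) / 1)) ∧
    (∫ t in ((2 : ℕ) : ℝ)..((2 : ℕ) : ℝ) + 1, (t - ((2 : ℕ) : ℝ)) * (Real.log t ^ 1 / t ^ 2)) =
    (Real.log 3 ^ 2 / 2 + 2 * ((Real.log 3 + 1) / 3)) -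
    (Real.log 2 ^ 2 / 2 + 2 * ((Real.log 2 + 1) / 2)) ∧
    (∫ t in ((3 : ℕ) : ℝ)..((3 : ℕ) : ℝ) + 1, (t - ((3 : ℕ) : ℝ)) * (Real.log t ^ 1 / t ^ 2)) =
        (Real.log 4 ^ 2 / 2 + 3 * ((Real.log 4 + 1) / 4)) -
        (Real.log 3 ^ 2 / 2 + 3 * ((Real.log 3 + 1) / 3)) := by
  refine ⟨?_, ?_, ?_⟩ <;> push_cast
  · rw [integral_mul_gk1 one_pos]; norm_num
  · have := integral_mul_gk1 (m := 2) (by norm_num); norm_num at this ⊢; exact this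
  · have := integral_mul_gk1 (m := 3) (by norm_num); norm_num at this ⊢; exact this

/-- The exact first values of `A₂`. [folklore] -/
theorem Ak_two_vals : (∫ t in ((1 : ℕ) : ℝ)..((1 : ℕ) : ℝ) + 1, (t - ((1 : ℕ) : ℝ)) *
    (Real.log t ^ 2 / t ^ 2)) = (Real.log 2 ^ 3 / 3 + 1 *
    ((Real.log 2 ^ 2 + 2 * Real.log 2 + 2) / 2)) - (Real.log 1 ^ 3 / 3 + 1 *
    ((Real.log 1 ^ 2 + 2 * Real.log 1 + 2) / 1)) ∧ (∫ t in ((2 : ℕ) : ℝ)..((2 : ℕ) : ℝ) + 1,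
    (t - ((2 : ℕ) : ℝ)) * (Real.log t ^ 2 / t ^ 2)) = (Real.log 3 ^ 3 / 3 + 2 *
    ((Real.log 3 ^ 2 + 2 * Real.log 3 + 2) / 3)) - (Real.log 2 ^ 3 / 3 + 2 *
    ((Real.log 2 ^ 2 + 2 * Real.log 2 + 2) / 2)) := by
  refine ⟨?_, ?_⟩ <;> push_cast
  · rw [integral_mul_gk2 one_pos]; norm_num
  · have := integral_mul_gk2 (m := 2) (by norm_num); norm_num at this ⊢; exact this

/-- Partial sums of `A₁`. [folklore] -/
theorem sum_Ak1_le (N : ℕ) :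
    ∑ m ∈ Finset.range N, (∫ t in ((m + 1 : ℕ) : ℝ)..((m + 1 : ℕ) : ℝ) + 1, (t - ((m + 1 : ℕ) : ℝ))
        * (Real.log t ^ 1 / t ^ 2)) ≤ (∫ t in ((1 : ℕ) : ℝ)..((1 : ℕ) : ℝ) + 1, (t - ((1 : ℕ) : ℝ))
        * (Real.log t ^ 1 / t ^ 2)) + (∫ t in ((2 : ℕ) : ℝ)..((2 : ℕ) : ℝ) + 1, (t - ((2 : ℕ) : ℝ))
        * (Real.log t ^ 1 / t ^ 2)) + (∫ t in ((3 : ℕ) : ℝ)..((3 : ℕ) : ℝ) + 1, (t - ((3 : ℕ) : ℝ))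
        * (Real.log t ^ 1 / t ^ 2)) + ((Real.log 4 + 1) / 4) / 2 := by
  have hnn : ∀ i, 0 ≤ (∫ t in ((i + 1 : ℕ) : ℝ)..((i + 1 : ℕ) : ℝ) + 1, (t - ((i + 1 : ℕ) : ℝ)) *
      (Real.log t ^ 1 / t ^ 2)) := fun i ↦ Ak_nonneg 1 (by omega)
  have hsub : ∑ m ∈ Finset.range N, (∫ t in ((m + 1 : ℕ) : ℝ)..((m + 1 : ℕ) : ℝ) + 1,
      (t - ((m + 1 : ℕ) : ℝ)) * (Real.log t ^ 1 / t ^ 2)) ≤ ∑ m ∈ Finset.range (3 + N),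
      (∫ t in ((m + 1 : ℕ) : ℝ)..((m + 1 : ℕ) : ℝ) + 1, (t - ((m + 1 : ℕ) : ℝ)) *
      (Real.log t ^ 1 / t ^ 2)) :=
    Finset.sum_le_sum_of_subset_of_nonneg (Finset.range_mono (Nat.le_add_left N 3))
      (fun i _ _ ↦ hnn i)
  refine hsub.trans ?_
  rw [Finset.sum_range_add]
  have h3 : ∑ x ∈ Finset.range 3, (∫ t in ((x + 1 : ℕ) : ℝ)..((x + 1 : ℕ) : ℝ) + 1,
      (t - ((x + 1 : ℕ) : ℝ)) * (Real.log t ^ 1 / t ^ 2)) =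
      (∫ t in ((1 : ℕ) : ℝ)..((1 : ℕ) : ℝ) + 1, (t - ((1 : ℕ) : ℝ)) * (Real.log t ^ 1 / t ^ 2)) +
      (∫ t in ((2 : ℕ) : ℝ)..((2 : ℕ) : ℝ) + 1, (t - ((2 : ℕ) : ℝ)) * (Real.log t ^ 1 / t ^ 2)) +
      (∫ t in ((3 : ℕ) : ℝ)..((3 : ℕ) : ℝ) + 1, (t - ((3 : ℕ) : ℝ)) * (Real.log t ^ 1 / t ^ 2)) :=
      by
    simp only [Finset.sum_range_succ, Finset.sum_range_zero, zero_add]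
  have htail : ∑ x ∈ Finset.range N, (∫ t in ((3 + x + 1 : ℕ) : ℝ)..((3 + x + 1 : ℕ) : ℝ) + 1,
      (t - ((3 + x + 1 : ℕ) : ℝ)) * (Real.log t ^ 1 / t ^ 2))
      ≤ ∑ x ∈ Finset.range N, (((Real.log ((x:ℝ) + 4) + 1) / ((x:ℝ) + 4)) -
          ((Real.log ((x:ℝ) + 4 + 1) + 1) / ((x:ℝ) + 4 + 1))) / 2 := by
    refine Finset.sum_le_sum fun x _ ↦ ?_
    have := Ak1_tail (m := 3 + x) (by omega)
    push_cast at this ⊢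
    refine this.trans (le_of_eq ?_)
    ring_nf
  have htel : ∑ x ∈ Finset.range N, (((Real.log ((x:ℝ) + 4) + 1) / ((x:ℝ) + 4)) -
      ((Real.log ((x:ℝ) + 4 + 1) + 1) / ((x:ℝ) + 4 + 1))) / 2
      = (((Real.log 4 + 1) / 4) - ((Real.log ((N:ℝ) + 4) + 1) / ((N:ℝ) + 4))) / 2 := by
    have := Finset.sum_range_sub' (fun i : ℕ ↦ ((Real.log ((i:ℝ) + 4) + 1) / ((i:ℝ) + 4)) / 2) N
    simp only [Nat.cast_zero, zero_add] at this
    rw [sub_div, ← this]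
    refine Finset.sum_congr rfl fun i _ ↦ ?_
    push_cast; ring_nf
  have hF : 0 ≤ ((Real.log ((N:ℝ) + 4) + 1) / ((N:ℝ) + 4)) :=
      (Fk_nonneg_aux (x := (N:ℝ) + 4) (by norm_cast; omega)).1
  rw [h3]
  linarith [htail, htel]

/-- Partial sums of `A₂` (upper). [folklore] -/
theorem sum_Ak2_le (N : ℕ) :
    ∑ m ∈ Finset.range N, (∫ t in ((m + 1 : ℕ) : ℝ)..((m + 1 : ℕ) : ℝ) + 1, (t - ((m + 1 : ℕ) : ℝ))
        * (Real.log t ^ 2 / t ^ 2)) ≤ (∫ t in ((1 : ℕ) : ℝ)..((1 : ℕ) : ℝ) + 1, (t - ((1 : ℕ) : ℝ))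
        * (Real.log t ^ 2 / t ^ 2)) + (∫ t in ((2 : ℕ) : ℝ)..((2 : ℕ) : ℝ) + 1, (t - ((2 : ℕ) : ℝ))
        * (Real.log t ^ 2 / t ^ 2)) + ((Real.log 3 ^ 2 + 2 * Real.log 3 + 2) / 3) / 2 := by
  have hnn : ∀ i, 0 ≤ (∫ t in ((i + 1 : ℕ) : ℝ)..((i + 1 : ℕ) : ℝ) + 1, (t - ((i + 1 : ℕ) : ℝ)) *
      (Real.log t ^ 2 / t ^ 2)) := fun i ↦ Ak_nonneg 2 (by omega)
  have hsub : ∑ m ∈ Finset.range N, (∫ t in ((m + 1 : ℕ) : ℝ)..((m + 1 : ℕ) : ℝ) + 1,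
      (t - ((m + 1 : ℕ) : ℝ)) * (Real.log t ^ 2 / t ^ 2)) ≤ ∑ m ∈ Finset.range (2 + N),
      (∫ t in ((m + 1 : ℕ) : ℝ)..((m + 1 : ℕ) : ℝ) + 1, (t - ((m + 1 : ℕ) : ℝ)) *
      (Real.log t ^ 2 / t ^ 2)) :=
    Finset.sum_le_sum_of_subset_of_nonneg (Finset.range_mono (Nat.le_add_left N 2))
      (fun i _ _ ↦ hnn i)
  refine hsub.trans ?_
  rw [Finset.sum_range_add]
  have h2 : ∑ x ∈ Finset.range 2, (∫ t in ((x + 1 : ℕ) : ℝ)..((x + 1 : ℕ) : ℝ) + 1,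
      (t - ((x + 1 : ℕ) : ℝ)) * (Real.log t ^ 2 / t ^ 2)) =
      (∫ t in ((1 : ℕ) : ℝ)..((1 : ℕ) : ℝ) + 1, (t - ((1 : ℕ) : ℝ)) * (Real.log t ^ 2 / t ^ 2)) +
      (∫ t in ((2 : ℕ) : ℝ)..((2 : ℕ) : ℝ) + 1, (t - ((2 : ℕ) : ℝ)) * (Real.log t ^ 2 / t ^ 2)) :=
      by
    simp only [Finset.sum_range_succ, Finset.sum_range_zero, zero_add]
  have htail : ∑ x ∈ Finset.range N, (∫ t in ((2 + x + 1 : ℕ) : ℝ)..((2 + x + 1 : ℕ) : ℝ) + 1,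
      (t - ((2 + x + 1 : ℕ) : ℝ)) * (Real.log t ^ 2 / t ^ 2))
      ≤ ∑ x ∈ Finset.range N, (((Real.log ((x:ℝ) + 3) ^ 2 + 2 * Real.log ((x:ℝ) + 3) + 2) /
          ((x:ℝ) + 3)) - ((Real.log ((x:ℝ) + 3 + 1) ^ 2 + 2 * Real.log ((x:ℝ) + 3 + 1) + 2) /
          ((x:ℝ) + 3 + 1))) / 2 := by
    refine Finset.sum_le_sum fun x _ ↦ ?_
    have := (Ak2_tail (m := 2 + x) (by omega)).1
    push_cast at this ⊢
    refine this.trans (le_of_eq ?_)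
    ring_nf
  have htel : ∑ x ∈ Finset.range N, (((Real.log ((x:ℝ) + 3) ^ 2 + 2 * Real.log ((x:ℝ) + 3) + 2) /
      ((x:ℝ) + 3)) - ((Real.log ((x:ℝ) + 3 + 1) ^ 2 + 2 * Real.log ((x:ℝ) + 3 + 1) + 2) /
      ((x:ℝ) + 3 + 1))) / 2
      = (((Real.log 3 ^ 2 + 2 * Real.log 3 + 2) / 3) - ((Real.log ((N:ℝ) + 3) ^ 2 + 2 * Real.log
          ((N:ℝ) + 3) + 2) / ((N:ℝ) + 3))) / 2 := by
    have := Finset.sum_range_sub' (fun i : ℕ ↦ ((Real.log ((i:ℝ) + 3) ^ 2 + 2 * Real.log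
        ((i:ℝ) + 3) + 2) / ((i:ℝ) + 3)) / 2) N
    simp only [Nat.cast_zero, zero_add] at this
    rw [sub_div, ← this]
    refine Finset.sum_congr rfl fun i _ ↦ ?_
    push_cast; ring_nf
  have hF : 0 ≤ ((Real.log ((N:ℝ) + 3) ^ 2 + 2 * Real.log ((N:ℝ) + 3) + 2) / ((N:ℝ) + 3)) :=
      (Fk_nonneg_aux (x := (N:ℝ) + 3) (by norm_cast; omega)).2.1
  rw [h2]
  linarith [htail, htel]

/-- Partial sums of `A₂` (lower). [folklore] -/
theorem sum_Ak2_ge (N : ℕ) :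
    (∫ t in ((1 : ℕ) : ℝ)..((1 : ℕ) : ℝ) + 1, (t - ((1 : ℕ) : ℝ)) * (Real.log t ^ 2 / t ^ 2)) +
        (∫ t in ((2 : ℕ) : ℝ)..((2 : ℕ) : ℝ) + 1, (t - ((2 : ℕ) : ℝ)) * (Real.log t ^ 2 / t ^ 2)) +
        (((Real.log 3 ^ 2 + 2 * Real.log 3 + 2) / 3) - ((Real.log ((N:ℝ) + 3) ^ 2 + 2 * Real.log
        ((N:ℝ) + 3) + 2) / ((N:ℝ) + 3))) / 2 - ((Real.log 3 ^ 2 / 3 ^ 2) -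
        (Real.log ((N:ℝ) + 3) ^ 2 / ((N:ℝ) + 3) ^ 2)) / 6
      ≤ ∑ m ∈ Finset.range (2 + N), (∫ t in ((m + 1 : ℕ) : ℝ)..((m + 1 : ℕ) : ℝ) + 1,
          (t - ((m + 1 : ℕ) : ℝ)) * (Real.log t ^ 2 / t ^ 2)) := by
  rw [Finset.sum_range_add]
  have h2 : ∑ x ∈ Finset.range 2, (∫ t in ((x + 1 : ℕ) : ℝ)..((x + 1 : ℕ) : ℝ) + 1,
      (t - ((x + 1 : ℕ) : ℝ)) * (Real.log t ^ 2 / t ^ 2)) =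
      (∫ t in ((1 : ℕ) : ℝ)..((1 : ℕ) : ℝ) + 1, (t - ((1 : ℕ) : ℝ)) * (Real.log t ^ 2 / t ^ 2)) +
      (∫ t in ((2 : ℕ) : ℝ)..((2 : ℕ) : ℝ) + 1, (t - ((2 : ℕ) : ℝ)) * (Real.log t ^ 2 / t ^ 2)) :=
      by
    simp only [Finset.sum_range_succ, Finset.sum_range_zero, zero_add]
  have htail : ∑ x ∈ Finset.range N, ((((Real.log ((x:ℝ) + 3) ^ 2 + 2 * Real.log ((x:ℝ) + 3) + 2) /
      ((x:ℝ) + 3)) - ((Real.log ((x:ℝ) + 3 + 1) ^ 2 + 2 * Real.log ((x:ℝ) + 3 + 1) + 2) /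
      ((x:ℝ) + 3 + 1))) / 2
      - ((Real.log ((x:ℝ) + 3) ^ 2 / ((x:ℝ) + 3) ^ 2) -
          (Real.log ((x:ℝ) + 3 + 1) ^ 2 / ((x:ℝ) + 3 + 1) ^ 2)) / 6)
        ≤ ∑ x ∈ Finset.range N, (∫ t in ((2 + x + 1 : ℕ) : ℝ)..((2 + x + 1 : ℕ) : ℝ) + 1,
            (t - ((2 + x + 1 : ℕ) : ℝ)) * (Real.log t ^ 2 / t ^ 2)) := by
    refine Finset.sum_le_sum fun x _ ↦ ?_
    have := (Ak2_tail (m := 2 + x) (by omega)).2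
    push_cast at this ⊢
    refine le_trans (le_of_eq ?_) this
    ring_nf
  have htel : ∑ x ∈ Finset.range N, ((((Real.log ((x:ℝ) + 3) ^ 2 + 2 * Real.log ((x:ℝ) + 3) + 2) /
      ((x:ℝ) + 3)) - ((Real.log ((x:ℝ) + 3 + 1) ^ 2 + 2 * Real.log ((x:ℝ) + 3 + 1) + 2) /
      ((x:ℝ) + 3 + 1))) / 2
      - ((Real.log ((x:ℝ) + 3) ^ 2 / ((x:ℝ) + 3) ^ 2) -
          (Real.log ((x:ℝ) + 3 + 1) ^ 2 / ((x:ℝ) + 3 + 1) ^ 2)) / 6)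
      = (((Real.log 3 ^ 2 + 2 * Real.log 3 + 2) / 3) - ((Real.log ((N:ℝ) + 3) ^ 2 + 2 * Real.log
          ((N:ℝ) + 3) + 2) / ((N:ℝ) + 3))) / 2 - ((Real.log 3 ^ 2 / 3 ^ 2) -
          (Real.log ((N:ℝ) + 3) ^ 2 / ((N:ℝ) + 3) ^ 2)) / 6 := by
    have := Finset.sum_range_sub' (fun i : ℕ ↦ ((Real.log ((i:ℝ) + 3) ^ 2 + 2 * Real.log
        ((i:ℝ) + 3) + 2) / ((i:ℝ) + 3)) / 2 - (Real.log ((i:ℝ) + 3) ^ 2 / ((i:ℝ) + 3) ^ 2) / 6) N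
    simp only [Nat.cast_zero, zero_add] at this
    rw [show (((Real.log 3 ^ 2 + 2 * Real.log 3 + 2) / 3) -
        ((Real.log ((N:ℝ) + 3) ^ 2 + 2 * Real.log ((N:ℝ) + 3) + 2) / ((N:ℝ) + 3))) / 2 -
        ((Real.log 3 ^ 2 / 3 ^ 2) - (Real.log ((N:ℝ) + 3) ^ 2 / ((N:ℝ) + 3) ^ 2)) / 6
      = (((Real.log 3 ^ 2 + 2 * Real.log 3 + 2) / 3) / 2 - (Real.log 3 ^ 2 / 3 ^ 2) / 6) -
          (((Real.log ((N:ℝ) + 3) ^ 2 + 2 * Real.log ((N:ℝ) + 3) + 2) / ((N:ℝ) + 3)) / 2 -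
          (Real.log ((N:ℝ) + 3) ^ 2 / ((N:ℝ) + 3) ^ 2) / 6) by ring, ← this]
    refine Finset.sum_congr rfl fun i _ ↦ ?_
    push_cast; ring_nf
  rw [h2]
  linarith [htail, htel]

/-- Partial sums of `A₃` (upper). [folklore] -/
theorem sum_Ak3_le (N : ℕ) :
    ∑ m ∈ Finset.range N, (∫ t in ((m + 1 : ℕ) : ℝ)..((m + 1 : ℕ) : ℝ) + 1, (t - ((m + 1 : ℕ) : ℝ))
        * (Real.log t ^ 3 / t ^ 2)) ≤ 5 * (0.16804 / 2) +
        ((Real.log 6 ^ 3 + 3 * Real.log 6 ^ 2 + 6 * Real.log 6 + 6) / 6) / 2 := by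
  have hnn : ∀ i, 0 ≤ (∫ t in ((i + 1 : ℕ) : ℝ)..((i + 1 : ℕ) : ℝ) + 1, (t - ((i + 1 : ℕ) : ℝ)) *
      (Real.log t ^ 3 / t ^ 2)) := fun i ↦ Ak_nonneg 3 (by omega)
  have hsub : ∑ m ∈ Finset.range N, (∫ t in ((m + 1 : ℕ) : ℝ)..((m + 1 : ℕ) : ℝ) + 1,
      (t - ((m + 1 : ℕ) : ℝ)) * (Real.log t ^ 3 / t ^ 2)) ≤ ∑ m ∈ Finset.range (5 + N),
      (∫ t in ((m + 1 : ℕ) : ℝ)..((m + 1 : ℕ) : ℝ) + 1, (t - ((m + 1 : ℕ) : ℝ)) *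
      (Real.log t ^ 3 / t ^ 2)) :=
    Finset.sum_le_sum_of_subset_of_nonneg (Finset.range_mono (Nat.le_add_left N 5))
      (fun i _ _ ↦ hnn i)
  refine hsub.trans ?_
  rw [Finset.sum_range_add]
  have h5 : ∑ x ∈ Finset.range 5, (∫ t in ((x + 1 : ℕ) : ℝ)..((x + 1 : ℕ) : ℝ) + 1,
      (t - ((x + 1 : ℕ) : ℝ)) * (Real.log t ^ 3 / t ^ 2)) ≤ 5 * (0.16804 / 2) := by
    have : ∀ x ∈ Finset.range 5, (∫ t in ((x + 1 : ℕ) : ℝ)..((x + 1 : ℕ) : ℝ) + 1,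
        (t - ((x + 1 : ℕ) : ℝ)) * (Real.log t ^ 3 / t ^ 2)) ≤ 0.16804 / 2 := fun x _ ↦ Ak3_crude
        (by omega)
    have h := Finset.sum_le_sum this
    simp only [Finset.sum_const, Finset.card_range, nsmul_eq_mul, Nat.cast_ofNat] at h
    linarith
  have htail : ∑ x ∈ Finset.range N, (∫ t in ((5 + x + 1 : ℕ) : ℝ)..((5 + x + 1 : ℕ) : ℝ) + 1,
      (t - ((5 + x + 1 : ℕ) : ℝ)) * (Real.log t ^ 3 / t ^ 2))
      ≤ ∑ x ∈ Finset.range N, (((Real.log ((x:ℝ) + 6) ^ 3 + 3 * Real.log ((x:ℝ) + 6) ^ 2 + 6 *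
          Real.log ((x:ℝ) + 6) + 6) / ((x:ℝ) + 6)) - ((Real.log ((x:ℝ) + 6 + 1) ^ 3 + 3 * Real.log
          ((x:ℝ) + 6 + 1) ^ 2 + 6 * Real.log ((x:ℝ) + 6 + 1) + 6) / ((x:ℝ) + 6 + 1))) / 2 := by
    refine Finset.sum_le_sum fun x _ ↦ ?_
    have := Ak3_tail (m := 5 + x) (by omega)
    push_cast at this ⊢
    refine this.trans (le_of_eq ?_)
    ring_nf
  have htel : ∑ x ∈ Finset.range N, (((Real.log ((x:ℝ) + 6) ^ 3 + 3 * Real.log ((x:ℝ) + 6) ^ 2 + 6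
      * Real.log ((x:ℝ) + 6) + 6) / ((x:ℝ) + 6)) - ((Real.log ((x:ℝ) + 6 + 1) ^ 3 + 3 * Real.log
      ((x:ℝ) + 6 + 1) ^ 2 + 6 * Real.log ((x:ℝ) + 6 + 1) + 6) / ((x:ℝ) + 6 + 1))) / 2
      = (((Real.log 6 ^ 3 + 3 * Real.log 6 ^ 2 + 6 * Real.log 6 + 6) / 6) -
          ((Real.log ((N:ℝ) + 6) ^ 3 + 3 * Real.log ((N:ℝ) + 6) ^ 2 + 6 * Real.log ((N:ℝ) + 6) + 6)
          / ((N:ℝ) + 6))) / 2 := by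
    have := Finset.sum_range_sub' (fun i : ℕ ↦ ((Real.log ((i:ℝ) + 6) ^ 3 + 3 * Real.log
        ((i:ℝ) + 6) ^ 2 + 6 * Real.log ((i:ℝ) + 6) + 6) / ((i:ℝ) + 6)) / 2) N
    simp only [Nat.cast_zero, zero_add] at this
    rw [sub_div, ← this]
    refine Finset.sum_congr rfl fun i _ ↦ ?_
    push_cast; ring_nf
  have hF : 0 ≤ ((Real.log ((N:ℝ) + 6) ^ 3 + 3 * Real.log ((N:ℝ) + 6) ^ 2 + 6 * Real.log
      ((N:ℝ) + 6) + 6) / ((N:ℝ) + 6)) := (Fk_nonneg_aux (x := (N:ℝ) + 6) (by norm_cast; omega)).2.2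
  linarith [htail, htel]

/-- Summability of `A₁` (bounded partial sums of non-negative terms). [folklore] -/
theorem summable_Ak1 : Summable fun m ↦ (∫ t in ((m + 1 : ℕ) : ℝ)..((m + 1 : ℕ) : ℝ) + 1,
    (t - ((m + 1 : ℕ) : ℝ)) * (Real.log t ^ 1 / t ^ 2)) :=
  summable_of_sum_range_le (fun _ ↦ Ak_nonneg 1 (by omega)) sum_Ak1_le

/-- Summability of `A₂`. [folklore] -/
theorem summable_Ak2 : Summable fun m ↦ (∫ t in ((m + 1 : ℕ) : ℝ)..((m + 1 : ℕ) : ℝ) + 1,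
    (t - ((m + 1 : ℕ) : ℝ)) * (Real.log t ^ 2 / t ^ 2)) :=
  summable_of_sum_range_le (fun _ ↦ Ak_nonneg 2 (by omega)) sum_Ak2_le

/-- Summability of `A₃`. [folklore] -/
theorem summable_Ak3 : Summable fun m ↦ (∫ t in ((m + 1 : ℕ) : ℝ)..((m + 1 : ℕ) : ℝ) + 1,
    (t - ((m + 1 : ℕ) : ℝ)) * (Real.log t ^ 3 / t ^ 2)) :=
  summable_of_sum_range_le (fun _ ↦ Ak_nonneg 3 (by omega)) sum_Ak3_le

/-- `J₁ = Σ A₁ ≤ 0.5029` (true value `0.49560…`; here `A₁(1), A₁(2), A₁(3)` exactly and the tail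
`≤ F₁(4)/2` by the Chebyshev estimate). [folklore] -/
theorem JA1_le : ∑' m, (∫ t in ((m + 1 : ℕ) : ℝ)..((m + 1 : ℕ) : ℝ) + 1, (t - ((m + 1 : ℕ) : ℝ)) *
    (Real.log t ^ 1 / t ^ 2)) ≤ 0.5029 := by
  refine (Real.tsum_le_of_sum_range_le (fun _ ↦ Ak_nonneg 1 (by omega)) sum_Ak1_le).trans ?_
  obtain ⟨e1, e2, e3⟩ := Ak_one_vals
  rw [e1, e2, e3]
  have log_four_eq : Real.log 4 = 2 * Real.log 2 := by
    rw [show (4:ℝ) = 2 ^ 2 by norm_num, Real.log_pow]; norm_num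
  simp only [Real.log_one, log_four_eq]
  have h2 := Real.log_two_gt_d9
  have h2' := Real.log_two_lt_d9
  have h3 := Real.log_three_gt_d9
  have h3' := Real.log_three_lt_d9
  have hsq : Real.log 2 ^ 2 ≤ 0.6931471808 ^ 2 := pow_le_pow_left₀ (by linarith) h2'.le 2
  norm_num
  linarith

/-- `J₂ = Σ A₂ ≥ 0.9895` (true value `1.00089…`). [folklore] -/
theorem JA2_ge : 0.9895 ≤ ∑' m, (∫ t in ((m + 1 : ℕ) : ℝ)..((m + 1 : ℕ) : ℝ) + 1,
    (t - ((m + 1 : ℕ) : ℝ)) * (Real.log t ^ 2 / t ^ 2)) := by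
  have hpart := summable_Ak2.sum_le_tsum (Finset.range (2 + 1048573))
    (fun m _ ↦ Ak_nonneg 2 (by omega))
  refine le_trans ?_ (le_trans (sum_Ak2_ge 1048573) hpart)
  obtain ⟨e1, e2⟩ := Ak_two_vals
  rw [e1, e2]
  have hbig : ((1048573 : ℕ) : ℝ) + 3 = 2 ^ 20 := by norm_num
  rw [hbig]
  have hlogbig : Real.log ((2:ℝ) ^ 20) = 20 * Real.log 2 := by rw [Real.log_pow]; norm_num
  have hg0 : 0 ≤ (Real.log ((2:ℝ) ^ 20) ^ 2 / ((2:ℝ) ^ 20) ^ 2) := by positivity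
  simp only [Real.log_one, hlogbig]
  have h2 := Real.log_two_gt_d9
  have h2' := Real.log_two_lt_d9
  have h3 := Real.log_three_gt_d9
  have h3' := Real.log_three_lt_d9
  have hsq2 : Real.log 2 ^ 2 ≤ 0.6931471808 ^ 2 := pow_le_pow_left₀ (by linarith) h2'.le 2
  have hsq3 : 1.0986122885 ^ 2 ≤ Real.log 3 ^ 2 := pow_le_pow_left₀ (by norm_num) h3.le 2
  have hcu3 : 1.0986122885 ^ 3 ≤ Real.log 3 ^ 3 := pow_le_pow_left₀ (by norm_num) h3.le 3
  have hsq3' : Real.log 3 ^ 2 ≤ 1.0986122888 ^ 2 := pow_le_pow_left₀ (by linarith) h3'.le 2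
  -- the tiny term `F₂(2²⁰)/2`
  have hF : ((20 * Real.log 2) ^ 2 + 2 * (20 * Real.log 2) + 2) / (2:ℝ) ^ 20 ≤ 0.00022 := by
    rw [div_le_iff₀ (by positivity)]
    nlinarith
  have hgbig : 0 ≤ (20 * Real.log 2) ^ 2 / ((2:ℝ) ^ 20) ^ 2 := by positivity
  norm_num at hF hgbig ⊢
  linarith

/-- `J₃ = Σ A₃ ≤ 3.1` (true value `3.0006…`; five crude intervals and the tail `≤ F₃(6)/2`).
[folklore] -/
theorem JA3_le : ∑' m, (∫ t in ((m + 1 : ℕ) : ℝ)..((m + 1 : ℕ) : ℝ) + 1, (t - ((m + 1 : ℕ) : ℝ)) *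
    (Real.log t ^ 3 / t ^ 2)) ≤ 3.1 := by
  refine (Real.tsum_le_of_sum_range_le (fun _ ↦ Ak_nonneg 3 (by omega)) sum_Ak3_le).trans ?_
  simp only [log_six_eq]
  have h2 := Real.log_two_gt_d9
  have h2' := Real.log_two_lt_d9
  have h3 := Real.log_three_gt_d9
  have h3' := Real.log_three_lt_d9
  have hs : Real.log 2 + Real.log 3 ≤ 1.7917594696 := by linarith
  have hs0 : 0 ≤ Real.log 2 + Real.log 3 := by linarith
  have hsq : (Real.log 2 + Real.log 3) ^ 2 ≤ 1.7917594696 ^ 2 := pow_le_pow_left₀ hs0 hs 2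
  have hcu : (Real.log 2 + Real.log 3) ^ 3 ≤ 1.7917594696 ^ 3 := pow_le_pow_left₀ hs0 hs 3
  norm_num
  linarith

/-- The lower bound for `T(1+u)`: `T(1+u) ≥ (1-γ) - u J₁ + (u²/2) J₂ - (u³/6) J₃`. [folklore] -/
theorem termTSum_ge {u : ℝ} (hu : 0 ≤ u) :
    (1 - Real.eulerMascheroniConstant) - u * ∑' m, (∫ t in ((m + 1 : ℕ) : ℝ)..((m + 1 : ℕ) : ℝ) +
        1, (t - ((m + 1 : ℕ) : ℝ)) * (Real.log t ^ 1 / t ^ 2)) + u ^ 2 / 2 * ∑' m,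
        (∫ t in ((m + 1 : ℕ) : ℝ)..((m + 1 : ℕ) : ℝ) + 1, (t - ((m + 1 : ℕ) : ℝ)) *
        (Real.log t ^ 2 / t ^ 2))
      - u ^ 3 / 6 * ∑' m, (∫ t in ((m + 1 : ℕ) : ℝ)..((m + 1 : ℕ) : ℝ) + 1, (t - ((m + 1 : ℕ) : ℝ))
          * (Real.log t ^ 3 / t ^ 2)) ≤ termTSum (1 + u) := by
  have hs0 : Summable (fun m ↦ term (m + 1) 1) := term_tsum_one.summable
  have hsT : Summable (fun m ↦ term (m + 1) (1 + u)) := summable_term (by linarith)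
  have hs1 := summable_Ak1
  have hs2 := summable_Ak2
  have hs3 := summable_Ak3
  have hle : ∀ m, term (m + 1) 1 - u * (∫ t in ((m + 1 : ℕ) : ℝ)..((m + 1 : ℕ) : ℝ) + 1,
      (t - ((m + 1 : ℕ) : ℝ)) * (Real.log t ^ 1 / t ^ 2)) + u ^ 2 / 2 *
      (∫ t in ((m + 1 : ℕ) : ℝ)..((m + 1 : ℕ) : ℝ) + 1, (t - ((m + 1 : ℕ) : ℝ)) *
      (Real.log t ^ 2 / t ^ 2))
      - u ^ 3 / 6 * (∫ t in ((m + 1 : ℕ) : ℝ)..((m + 1 : ℕ) : ℝ) + 1, (t - ((m + 1 : ℕ) : ℝ)) *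
          (Real.log t ^ 3 / t ^ 2)) ≤ term (m + 1) (1 + u) := fun m ↦ term_ge_taylor m.succ_pos hu
  have hsL : Summable (fun m ↦ term (m + 1) 1 - u * (∫ t in ((m + 1 : ℕ) : ℝ)..((m + 1 : ℕ) : ℝ) +
      1, (t - ((m + 1 : ℕ) : ℝ)) * (Real.log t ^ 1 / t ^ 2)) + u ^ 2 / 2 *
      (∫ t in ((m + 1 : ℕ) : ℝ)..((m + 1 : ℕ) : ℝ) + 1, (t - ((m + 1 : ℕ) : ℝ)) *
      (Real.log t ^ 2 / t ^ 2))
      - u ^ 3 / 6 * (∫ t in ((m + 1 : ℕ) : ℝ)..((m + 1 : ℕ) : ℝ) + 1, (t - ((m + 1 : ℕ) : ℝ)) *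
          (Real.log t ^ 3 / t ^ 2))) :=
    ((hs0.sub (hs1.mul_left u)).add (hs2.mul_left _)).sub (hs3.mul_left _)
  have h := Summable.tsum_le_tsum hle hsL hsT
  rw [((hs0.sub (hs1.mul_left u)).add (hs2.mul_left _)).tsum_sub (hs3.mul_left _),
    (hs0.sub (hs1.mul_left u)).tsum_add (hs2.mul_left _), hs0.tsum_sub (hs1.mul_left u),
    tsum_mul_left, tsum_mul_left, tsum_mul_left, term_tsum_one.tsum_eq] at h
  exact h


/-! #### The polynomial step and the regime `1 < σ ≤ 3/2` -/

/-- The polynomial inequality: for `0 ≤ u ≤ 1/2` and `0.57721558 ≤ g ≤ 0.57721571`,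
`1 + u − u(1+u)[(1 − g) − 0.5029u + 0.9895u²/2 − 3.1u³/6] ≤ Σ_{k ≤ 5} (gu)^k/k!`
(the difference is `u²·R(u, g)` with `R ≥ 0.017`). [folklore] -/
theorem poly_step {u g : ℝ} (hu0 : 0 ≤ u) (hu : u ≤ 1 / 2) (hg1 : 0.57721558 ≤ g)
    (hg2 : g ≤ 0.57721571) :
    1 + u - u * (1 + u) * ((1 - g) - 0.5029 * u + 0.9895 * u ^ 2 / 2 - 3.1 * u ^ 3 / 6)
      ≤ 1 + g * u + (g * u) ^ 2 / 2 + (g * u) ^ 3 / 6 + (g * u) ^ 4 / 24 + (g * u) ^ 5 / 120 := by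
  have hg0 : (0:ℝ) ≤ 0.57721558 := by norm_num
  have hp2 : (0.57721558:ℝ) ^ 2 ≤ g ^ 2 := pow_le_pow_left₀ hg0 hg1 2
  have hp3 : (0.57721558:ℝ) ^ 3 ≤ g ^ 3 := pow_le_pow_left₀ hg0 hg1 3
  have hp4 : (0.57721558:ℝ) ^ 4 ≤ g ^ 4 := pow_le_pow_left₀ hg0 hg1 4
  have hp5 : (0.57721558:ℝ) ^ 5 ≤ g ^ 5 := pow_le_pow_left₀ hg0 hg1 5
  have key : (1 + g * u + (g * u) ^ 2 / 2 + (g * u) ^ 3 / 6 + (g * u) ^ 4 / 24 + (g * u) ^ 5 / 120)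
      - (1 + u - u * (1 + u) * ((1 - g) - 0.5029 * u + 0.9895 * u ^ 2 / 2 - 3.1 * u ^ 3 / 6))
      = u ^ 2 * ((g ^ 2 / 2 + 1 - g - 0.5029) + u * (g ^ 3 / 6 - 0.5029 + 0.9895 / 2)
        + u ^ 2 * (g ^ 4 / 24 + 0.9895 / 2 - 3.1 / 6) + u ^ 3 * (g ^ 5 / 120 - 3.1 / 6)) := by
    ring
  have t1 : 0 ≤ u * (g ^ 3 / 6 - 0.5029 + 0.9895 / 2) :=
    mul_nonneg hu0 (by norm_num at hp3 ⊢; linarith)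
  have c2 : (-0.0172914:ℝ) ≤ g ^ 4 / 24 + 0.9895 / 2 - 3.1 / 6 := by norm_num at hp4 ⊢; linarith
  have c3 : (-0.5161328:ℝ) ≤ g ^ 5 / 120 - 3.1 / 6 := by norm_num at hp5 ⊢; linarith
  have t2 : -0.0172914 * u ^ 2 ≤ u ^ 2 * (g ^ 4 / 24 + 0.9895 / 2 - 3.1 / 6) := by
    have := mul_le_mul_of_nonneg_left c2 (sq_nonneg u); linarith
  have t3 : -0.5161328 * u ^ 3 ≤ u ^ 3 * (g ^ 5 / 120 - 3.1 / 6) := by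
    have := mul_le_mul_of_nonneg_left c3 (pow_nonneg hu0 3); linarith
  have hu2 : u ^ 2 ≤ 1 / 4 := by nlinarith
  have hu3 : u ^ 3 ≤ 1 / 8 := by nlinarith
  have hB : 0 ≤ (g ^ 2 / 2 + 1 - g - 0.5029) + u * (g ^ 3 / 6 - 0.5029 + 0.9895 / 2)
      + u ^ 2 * (g ^ 4 / 24 + 0.9895 / 2 - 3.1 / 6) + u ^ 3 * (g ^ 5 / 120 - 3.1 / 6) := by
    norm_num at hp2 ⊢
    linarith
  have : 0 ≤ u ^ 2 * ((g ^ 2 / 2 + 1 - g - 0.5029) + u * (g ^ 3 / 6 - 0.5029 + 0.9895 / 2)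
      + u ^ 2 * (g ^ 4 / 24 + 0.9895 / 2 - 3.1 / 6) + u ^ 3 * (g ^ 5 / 120 - 3.1 / 6)) :=
    mul_nonneg (sq_nonneg u) hB
  linarith [key]

/-- Regime `1 < σ ≤ 3/2`. [folklore] -/
theorem main_small {σ : ℝ} (h1 : 1 < σ) (h2 : σ ≤ 3 / 2) :
    (riemannZeta σ).re ≤ Real.exp (Real.eulerMascheroniConstant * (σ - 1)) / (σ - 1) := by
  obtain ⟨u, rfl⟩ : ∃ u : ℝ, σ = 1 + u := ⟨σ - 1, by ring⟩
  have hu0 : 0 < u := by linarith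
  have hu : u ≤ 1 / 2 := by linarith
  rw [re_zeta_eq h1, add_sub_cancel_left, le_div_iff₀ hu0]
  have hg1 : (0.57721558 : ℝ) < Real.eulerMascheroniConstant :=
    Literature.Analysis.SpecialFunctions.Real.eulerMascheroniConstant_gt_d8
  have hg2 : Real.eulerMascheroniConstant < 0.57721571 :=
    Literature.Analysis.SpecialFunctions.Real.eulerMascheroniConstant_lt_d8
  have hT := termTSum_ge hu0.le
  have hJ1 := mul_le_mul_of_nonneg_left JA1_le hu0.le
  have hJ2 := mul_le_mul_of_nonneg_left JA2_ge (by positivity : (0:ℝ) ≤ u ^ 2 / 2)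
  have hJ3 := mul_le_mul_of_nonneg_left JA3_le (by positivity : (0:ℝ) ≤ u ^ 3 / 6)
  have hTlo : (1 - Real.eulerMascheroniConstant) - 0.5029 * u + 0.9895 * u ^ 2 / 2 - 3.1 * u ^ 3 /
      6 ≤ termTSum (1 + u) := by
    linarith
  have hP : 1 + u - u * (1 + u) * termTSum (1 + u)
      ≤ 1 + u - u * (1 + u) * ((1 - Real.eulerMascheroniConstant) - 0.5029 * u + 0.9895 * u ^ 2 / 2
          - 3.1 * u ^ 3 / 6) := by
    have := mul_le_mul_of_nonneg_left hTlo (by positivity : (0:ℝ) ≤ u * (1 + u))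
    linarith
  have hE := poly_step hu0.le hu hg1.le hg2.le
  have hexp := quintic_le_exp (x := Real.eulerMascheroniConstant * u) (by positivity)
  have e : (1 / u + 1 - (1 + u) * termTSum (1 + u)) * u
      = 1 + u - u * (1 + u) * termTSum (1 + u) := by
    field_simp
  rw [e]
  linarith

end ZetaRealLeRamare

/-- **Ramaré's bound** (Bastien–Rogalski 2002, Lemme 1, eq. (6); Mossinghoff–Trudgian–Yang (3.2)),
PROVED: for real `σ > 1`, `ζ(σ) ≤ e^{γ(σ−1)}/(σ − 1)`. Discharges the named fact
`Literature.NumberTheory.LFunctions.zeta_real_le_ramare`.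
[cite: BastienRogalski2002, Lemme 1, (6)] [cite: MossinghoffTrudgianYangRNT2024, (3.2)] -/
theorem zeta_real_le_ramare_holds : zeta_real_le_ramare := by
  intro σ hσ
  rcases le_or_gt σ (3 / 2) with h | h
  · exact ZetaRealLeRamare.main_small hσ h
  rcases le_or_gt σ 2 with h' | h'
  · exact ZetaRealLeRamare.main_mid h.le h'
  · exact ZetaRealLeRamare.main_two_le h'.le


/-! ## Patel's sub-Weyl bound on the critical line (discharge of `zeta_half_line_patel`)

The high range `t ≥ e⁵⁶` is `Literature.NumberTheory.LFunctions.VdC.norm_zeta_half_le_Lambda`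
(Patel–Yang's `ABA³B` argument with the tree's explicit `A`/`B`-processes and Yang's explicit
derivative tests, all proved) at `t₀ = e⁵⁶, ρ₁ = 81/80, H₁ = 1.0126, η₁ = 2, θ₁ = 1/4, θ₂ = 1/2,
ρ₂ = 9/8, H₂ = 1.1252, η₂ = 1, M₀ = 10⁴`, where the generated certificate
`Literature.NumberTheory.LFunctions.VdC.Num.pyLambda_v_hi` gives `Λ ≤ 209.1 < 307.098`; the low
range `3 ≤ |t| ≤ e⁵⁶` is Lehman's bound (`…PatelSubWeylLowRange`). -/

namespace PatelHighRange

open VdC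

/-- `e^{56·7/17} ≥ 20250`. [folklore] -/
theorem exp56_717_ge : (20250 : ℝ) ≤ Real.exp 56 ^ (7 / 17 : ℝ) := by
  rw [Num.exp56_rpow]
  exact le_trans (by norm_num) (Num.one_add_div_pow_le_exp (a := 56 * (7 / 17 : ℝ)) (by norm_num) 8 (by norm_num))

/-- The side conditions of `norm_zeta_half_le_Lambda` at `t₀ = e⁵⁶` and the bound
`‖ζ(½+it)‖ ≤ 307.098 t^{27/164}` for `t ≥ e⁵⁶`. [cite: PatelYang2024, Theorem 1.1] -/
theorem norm_zeta_half_le_high {t : ℝ} (ht : Real.exp 56 ≤ t) :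
    ‖riemannZeta (1 / 2 + t * Complex.I)‖ ≤ 307.098 * t ^ (27 / 164 : ℝ) := by
  have hπ3 : π < 3.15 := by linarith [Real.pi_lt_d2]
  have hπ2 : 2 ≤ π := Real.two_le_pi
  have hE := exp56_717_ge
  have he56 : (841 : ℝ) ≤ Real.exp 56 := by
    have := Num.one_add_div_pow_le_exp (a := (56 : ℝ)) (by norm_num) 2 (by norm_num)
    exact le_trans (by norm_num) this
  have ht₀π : 128 * π ≤ Real.exp 56 := by nlinarith
  have hlog : 1 ≤ 27 / 164 * Real.log (Real.exp 56) := by rw [Real.log_exp]; norm_num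
  have hH₁ : (81 / 80 : ℝ) * (1 + 1 / ((1 / 2 : ℝ) * Real.exp 56 ^ (7 / 17 : ℝ))) ≤ 10126 / 10000 := by
    have h1 : 1 / ((1 / 2 : ℝ) * Real.exp 56 ^ (7 / 17 : ℝ)) ≤ 1 / ((1 / 2 : ℝ) * 20250) :=
      one_div_le_one_div_of_le (by norm_num) (by nlinarith)
    nlinarith
  have hsq : Real.sqrt (2 * π) ≤ 2.51 := Num.sqrt_le_of_le_sq (by norm_num) (by nlinarith)
  have hsq2 : 2 ≤ Real.sqrt (2 * π) := Num.le_sqrt_of_sq_le (by norm_num) (by nlinarith)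
  have hθ₂π : 1 ≤ (1 / 2 : ℝ) * Real.sqrt (2 * π) := by linarith
  have hZ1 : 1 ≤ (1 / 2 : ℝ) * Real.exp 56 ^ (7 / 17 : ℝ) := by linarith
  have hZx : ((1 / 2 : ℝ) + Real.exp 56 ^ (-(7 / 17 : ℝ))) * Real.sqrt (2 * π) ≤ Real.exp 56 ^ (3 / 34 : ℝ) := by
    have h1 : Real.exp 56 ^ (-(7 / 17 : ℝ)) ≤ 1 :=
      Real.rpow_le_one_of_one_le_of_nonpos (by linarith) (by norm_num)
    have h2 : (5.94 : ℝ) ≤ Real.exp 56 ^ (3 / 34 : ℝ) := by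
      rw [Num.exp56_rpow]
      have := Real.add_one_le_exp (56 * (3 / 34 : ℝ))
      exact le_trans (by norm_num) this
    have h0 : 0 ≤ Real.exp 56 ^ (-(7 / 17 : ℝ)) := Real.rpow_nonneg (Real.exp_pos 56).le _
    nlinarith
  have hM₀ : 2 * (9 / 8 : ℝ) ≤ 10000 := by norm_num
  have hM₀Z : (10000 : ℝ) ≤ (1 / 2 : ℝ) * Real.exp 56 ^ (7 / 17 : ℝ) + 1 := by linarith
  have hH₂ : (9 / 8 : ℝ) * (1 + 1 / ((10000 : ℝ) / (9 / 8) - 1)) ≤ 11252 / 10000 := by norm_num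
  have h := norm_zeta_half_le_Lambda (t := t) (η₁ := 2) (θ₁ := 1 / 4) (η₂ := 1) ht₀π hlog ht
    (by norm_num : (1 : ℝ) < 81 / 80) hH₁ (by norm_num) (by norm_num) (by norm_num) hθ₂π hZ1 hZx
    (by norm_num : (1 : ℝ) < 9 / 8) hM₀ hM₀Z hH₂ (by norm_num)
  have ht0 : 0 < t := (Real.exp_pos 56).trans_le ht
  refine h.trans (mul_le_mul_of_nonneg_right ?_ (Real.rpow_nonneg ht0.le _))
  exact Num.pyLambda_v_hi.trans (by norm_num)

end PatelHighRange

/-- **Patel's explicit sub-Weyl bound** (Patel 2021 thesis; Patel–Yang 2024, (1.2)):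
`|ζ(½+it)| ≤ 307.098|t|^{27/164}` for `|t| ≥ 3` — the discharge of the named fact
`Literature.NumberTheory.LFunctions.zeta_half_line_patel`. High range from
`Literature.NumberTheory.LFunctions.PatelHighRange.norm_zeta_half_le_high`, low range and the
reduction to `t > 0` from `Literature.NumberTheory.LFunctions.zeta_half_line_patel_of_highRange`.
[cite: PatelYang2024, (1.2)] -/
theorem zeta_half_line_patel_holds : zeta_half_line_patel :=
  zeta_half_line_patel_of_highRange fun _ ht => PatelHighRange.norm_zeta_half_le_high ht


end Literature.NumberTheory.LFunctions
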